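import Literature.NumberTheory.LFunctions.GreatestRealZeroElementaryProofs
import Literature.NumberTheory.LFunctions.DeuringPhenomenonElementaryProofs
import HarnessLib

/-!
# Pintz 1976 (III), §2: Lemma 1 — `L'(1) = ∏_{p∣D}(1 + 1/p)(π²/6)(1 + O(1/log D)) > 1` — and
# Theorem 1 — the single simple real zero `1 − δ` in `H = {|1 − s| ≤ 1/log⁴D}`,
# `δ = 6h(−D)(1 + O(1/log D))/(π∏_{p∣D}(1+1/p)√D)` — under `h(−D) ≤ log D/(2 log log D)`: PROVED
# (`pintz1976Deuring_lemma1_holds`, `pintz1976Deuring_theorem1_holds`)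

Topic `Literature/NumberTheory/LFunctions` (namespace `Literature.NumberTheory.LFunctions`, helpers in
the statement file's grouping sub-namespace `Pintz1976Deuring`). PROOF LAYER for the statement file
`DeuringPhenomenonElementary.lean` (cell `parity-realchar` — SIEGEL INSTRUMENT, conditionals column, the
Deuring direction; row (7) of the literature-typing layer). The named facts

* `pintz1976Deuring_lemma1` — J. Pintz, *Elementary methods in the theory of L-functions, III. The
  Deuring-phenomenon*, Acta Arith. **31** (1976) 295–306, Lemma 1 (p. 297, (2.1)): "If (1.3)
  [`h(−D) ≤ log D/(2 log log D)`] is valid, then the relation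
  `L'(1) = ∏_{p∣D}(1 + 1/p)(π²/6)(1 + O(1/log D)) > 1` holds. This is Theorem 2 in [6]."
* `pintz1976Deuring_theorem1` — ibid., Theorem 1 (p. 296, (1.3)–(1.6)): under (1.3), "`L(s)` has a
  single simple real zero `1 − δ` in `H = {s ; |1 − s| ≤ 1/log⁴D}`, for which one has
  `δ = (L(1)/(∏_{p∣D}(1+1/p)π²/6))(1 + O(1/log D)) = 6h(−D)(1 + O(1/log D))/(∏_{p∣D}(1+1/p)π√D)`,
  and for `s ∈ H` the relation `L(s) − L(1) = (s − 1)∏_{p∣D}(1+1/p)(π²/6)(1 + O(1/log D))` holds."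

(both typed over imaginary quadratic fields `K`, `D = |d_K| > D₁`, `h(−D) = h_K`, `χ` the odd real
primitive character mod `D`, with `∃ C D₁` for the effective `O` and the standing assumption
"`D > D₁`", p. 296) are discharged here as `theorem pintz1976Deuring_lemma1_holds :
pintz1976Deuring_lemma1` and `theorem pintz1976Deuring_theorem1_holds : pintz1976Deuring_theorem1`.
The statement file is untouched; the typed `Prop`s are proved literally. Everything in this file is
PROVED (theorems only; no definition, no named fact, no new hypothesis).

## Source and road

Source READ first-hand: the journal scan `matwbn.icm.edu.pl/ksiazki/aa/aa31/aa31311.pdf` (corpus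
`paper:url-dc41f4bea12a`, image-only; pp. 296–297 rendered by this seat, pp. 298–300 by
littype-FP2-1 g28, renders under `run/shared/lean/pub/parity-realchar/littype-FP2-1/pintz1976III-pages-g28/`),
and part II (Acta Arith. **31** (1976) 273–289, §3 pp. 282–283, the tree's
`GreatestRealZeroElementaryProofs.lean`).

PRINT (III, p. 297): "Theorem 1 will easily follow from the results of the paper II of this series [6]
(the main result, the formula (1.5) is even contained in it), because the most critical point, the
calculation of `L'(1)` was made already in [6]. … LEMMA 1. If (1.3) is valid, then the relation (2.1)
`L'(1) = ∏_{p∣D}(1 + 1/p)(π²/6)(1 + O(1/log D)) > 1` holds. This is Theorem 2 in [6]. LEMMA 2. If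
(1.3) holds, then for `s ∈ H` one has (2.2) `L'(s) = L'(1)(1 + O(1/log D)) ≠ 0`. Proof. Using the
known inequality (2.3) `L''(s) = O(log³D)` for `s ∈ H` (which one can easily prove by partial
summation) we have `L'(1) − L'(s) = ∫_s^1 L''(z)dz = O(|1 − s| log³D) = O(1/log D) = O(L'(1)/log D)`,
since by Lemma 1 `L'(1) > 1`. LEMMA 3. If (1.3) holds, then for `s₁, s₂ ∈ H`, `s₁ ≠ s₂`,
`L(s₁) ≠ L(s₂)`. Proof. … (2.4) `L(s₂) − L(s₁) = ∫_{s₁}^{s₂} L'(z)dz = (s₂ − s₁)L'(1)(1 + O(1/log D))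
≠ 0`." (p. 298): "So from Lemma 2 and Lemma 3 we know that `L(s)` can have at most one, simple zero
in the domain `H`. On the other hand for the real `s = 1 − τ ∈ H` we have by (2.4)
`L(1 − τ) = L(1) − τL'(1)(1 + O(1/log D))`. Here `L(1 − τ) > 0` for `τ = τ₁ = L(1)/(2L'(1))`,
`L(1 − τ) < 0` for `τ = τ₂ = 2L(1)/L'(1)`, because here `1 − τ₁` and `1 − τ₂` belong to `H`. Thus
`L(s)` has a real zero `1 − δ`, for which the relation `δ = (L(1)/L'(1))(1 + O(1/log D)) =
(L(1)/(∏(1+1/p)π²/6))(1 + O(1/log D))` holds, and (2.4) gives with `s₁ = 1` the relation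
`L(s) − L(1) = (s − 1)∏(1+1/p)(π²/6)(1 + O(1/log D))` which proves Theorem 1."
Part II proves its Theorem 2 (`L(1)/δ ∼ (π²/6)∏_{p∣D}(1 + 1/p)`, printed with `∼`) in §3 from
`S = Σ_{n≤D²} g(n)/n`, `g = 1 ∗ χ ≥ 0`: (2.3) `S = L'(1) + (2 log D + γ)L(1) + O(√(√D log³D/D))`;
(2.8) `S ≥ ∏_{p∣D}(1 + 1/p) Σ_{l≤√D} 1/l²`; (3.2) "if `1 ≤ n ≤ √D/2` and all prime divisors of `n`
have `(−D/p) = 1` then `n ∈ H(−D)`, `|H(−D)| ≤ h(−D)`"; (3.3)–(3.4) `Σ_{p ≤ √D/2 split} 1/p ≤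
h(√D/2)^{−1/h} ≤ 2/log log D`; (3.5)–(3.6) `(Σ_{√D/2 < p ≤ D² split} 1/p)² = o(1)`; (3.7)
`S ≤ exp(4 Σ_{p ≤ D² split} 1/p)(π²/6)∏_{p∣D}(1 + 1/p)`.

HERE, in the same order. Lemma 1 on the tree's PROVED part-II engines (`Pintz1976.abs_gSum_sq_sub_le`
(2.3), `prod_mul_sum_inv_sq_le_gSum` (2.8), `card_le_classNumber_of_splitFactors` (3.2),
`lt_four_mul_pow_classNumber_sq` (3.3), `sq_sum_inv_splitPrimes_le` (3.5), `gSum_sq_le_exp_mul_prod`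
(3.7)) and the class number formula `L(1) = π h_K/√D` (`Quadratic.LFunction_one_eq_of_discr_neg_of_eq`,
`w_K = 2`):

* **Part L ((3.4) with the rate).** Under (1.3) every step of part II is power-saving in `D` except
  (3.4), whose printed bound `2/log log D` does not give `O(1/log D)`. The count (3.2) gives more:
  `Pintz1976Deuring.two_mul_add_one_le_classNumber` — two distinct split primes `p, p'` with
  `p^a, p'^a ≤ √D/2` cost `2a + 1 ≤ h` (the integers `1, p, …, p^a, p', …, p'^a`); hence
  (`sum_inv_smallSplitPrimes_le_rate`) at most ONE split prime lies below `(√D/2)^{1/⌊(h+1)/2⌋}`, it is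
  `> (√D/2)^{1/h}` by (3.3), and `Σ_{p ≤ √D/2 split} 1/p ≤ (4/D)^{1/(2h)} + (h − 1)(4/D)^{1/(h+1)}`,
  which is `≤ (4 + e^{16 + 4 log 4}/2)/log D` for `1 ≤ h ≤ log D/(2 log log D)`, `log log D ≥ 1`
  (`smallSplit_rate_le`: `(4/D)^{1/(2h)} ≤ 4/log D`, `(4/D)^{1/(h+1)} ≤ e^{16+4 log 4}/log²D`).
* **Part M (assembly of Lemma 1).** The remaining terms are `O(log²D/√D)`, `O(1/√D)`,
  `O(log D/D^{1/8})`, made explicit by `log^k x ≤ (k/a)^k x^a`: (2.3)-error `≤ 10372/log D`,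
  `(2 log D + γ)L(1) ≤ 1296/log D` (`h ≤ log D/2`, `γ < 2/3`, `π ≤ 4`), `ζ(2)`-tail
  `2/(⌊√D⌋ + 1) ≤ 4/log D` (`π²/6 − 2/(N+1) ≤ Σ_{l≤N} 1/l²`, Mathlib `hasSum_zeta_two` +
  `sum_Ioo_inv_sq_le`), (3.5)-term `≤ 10797/log D` (`D ≥ 256`); with `e^{4σ} ≤ 1 + 8σ` (`σ ≤ 1/4`)
  the pure-real lemma `Pintz1976Deuring.lemma1_real` gives `|L'(1)/(P π²/6) − 1| ≤ 11A/log D` and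
  `L'(1) ≥ (13/16)(3/2)P > 1` once `log D ≥ 16A`; `lemma1_aux` (modulus as a separate variable) and
  `pintz1976Deuring_lemma1_holds` (`C = 11A`, `A = 10372 + 1296 + 4 + 10797 + 4 + e^{16+4 log 4}/2`,
  `D₁ = max(256, ⌈e^e⌉, ⌈e^{16A}⌉)`).
* **Part N (Lemma 2, (2.3), (2.4)).** `norm_LFunction_le_near_one`: for `χ ≠ χ₀` mod `q ≥ 3`,
  `log q ≥ 2`, `‖s − 1‖ ≤ 1/log q`: `‖L(s, χ)‖ ≤ 141 log q` (partial summation: `n^{−σ} ≤ e/n` for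
  `n ≤ q`, `Σ_{n≤q} 1/n ≤ 1 + log q`, and the tail `‖Σ_{n≤q} χ(n)n^{−s} − L(s, χ)‖ ≤ B(1 + |s|/σ)q^{−σ}`
  of the Lemma-4 file, `Pintz1976Deuring.norm_sum_char_cpow_sub_LFunction_le`, with the tree's
  Pólya–Vinogradov `B ≤ 9√q log q`); Cauchy's estimate on circles of radius `1/(3 log q)` twice
  (Mathlib `Complex.norm_deriv_le_of_forall_mem_sphere_norm_le`): `‖L'‖ ≤ 423 log²q` on
  `‖s − 1‖ ≤ 2/(3 log q)` and (2.3) `‖L''‖ ≤ 1269 log³q` on `‖s − 1‖ ≤ 1/(3 log q)`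
  (`norm_deriv_deriv_LFunction_le_near_one`); the mean value inequality
  (`Convex.norm_image_sub_le_of_norm_deriv_le`) gives Lemma 2 as `‖L'(s) − L'(1)‖ ≤ 1269 log³q·‖s − 1‖`
  (`norm_deriv_LFunction_sub_le`) and, applied to `L(z) − zL'(1)`, (2.4) as
  `‖L(s₂) − L(s₁) − (s₂ − s₁)L'(1)‖ ≤ 1269 log³q·ρ·‖s₂ − s₁‖` for `‖sᵢ − 1‖ ≤ ρ ≤ 1/(3 log q)`
  (`norm_LFunction_sub_sub_le`); with `ρ = 1/log⁴D ⊇ H` the factor is `1269/log D`.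
* **Part O (Theorem 1, p. 298).** `theorem1_aux`: with `L(1) = πh/√D > 0`, `L'(1) > 1` real
  (`ExceptionalZero.deriv_LFunction_ofReal_im_eq_zero`), `τ₁ = L(1)/(2L'(1))`, `τ₂ = 2L(1)/L'(1) ≤ 2L(1)
  ≤ π log D/√D ≤ 1/log⁴D` (`π log⁵D ≤ √D` for `D ≥ 12800000⁴`): (2.4) at the real points gives
  `Re L(1 − τ₁) > 0 > Re L(1 − τ₂)` once `log D > 5076`, the intermediate value theorem
  (`intermediate_value_Icc`) a real `σ₀ ∈ [1 − τ₂, 1 − τ₁]` with `Re L(σ₀) = 0`, hence `L(σ₀) = 0`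
  (`DirichletAbel.LFunction_ofReal_im_eq_zero`), `δ = 1 − σ₀`; simplicity from Lemma 2
  (`‖L'(σ₀) − L'(1)‖ ≤ 1269/log D < 1 < L'(1)`); uniqueness in `H` from (2.4) (Lemma 3: a second zero
  `s` would give `|L'(1)| ≤ 1269/log D`); (1.5) from `|δL'(1) − L(1)| ≤ 1269δ/log D ≤ 2538 L(1)/log D`
  and Lemma 1 (`ratio_bound`: `|δ/(L(1)/Z) − 1| ≤ 2(a + b)`), its second form being the same quantity
  by `L(1) = πh/√D`; (1.6) from (2.4) with `s₁ = 1` and `|L'(1) − Z| ≤ Z·C₁/log D`. Constants: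
  `C = 4·1269 + 2|C₁|` (`C₁` the Lemma-1 constant), `D₁ = max(D₁(Lemma 1), ⌈e^e⌉, ⌈12800000⁴⌉, 5,
  ⌈e^C⌉)`.

DECLARED DEVIATIONS from print: (i) part II's (3.4) is replaced by the sharper count of Part L (same
input (3.2), i.e. Davenport's Hilfssatz in the tree's Lenstra–Pomerance form) — this is where the rate
`1/log D` claimed on p. 297 ("contained in [6]") actually comes from; the printed chain
`h(√D/2)^{−1/h} ≤ 2/log log D` alone yields only `L'(1) = ∏(1+1/p)(π²/6)(1 + O(1/log log D))`;
(ii) as in the tree's part-II proofs, (2.3) of II enters in the Montgomery–Vaughan 11.2.3(g) form with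
the tree's Pólya–Vinogradov constant, not with the printed `5ϑ` of II (2.1); (iii) the "known
inequality" `L''(s) = O(log³D)` ((2.3) of III, "by partial summation") is obtained from the
partial-summation bound `L(s) = O(log D)` on `|s − 1| ≤ 1/log D` by two Cauchy estimates, and the
integrals `∫L''`, `∫L'` of (2.2), (2.4) are rendered by the mean value inequality on the (convex)
discs — same content, no contour integration; (iv) `C`, `D₁` are explicit but crude (the print only
claims "effective", p. 296). No constant or quantifier of the typed statements is changed.

LABEL (cell rule): instrument provenance (two named hypotheses of the conditionals column turned into
theorems); nothing here bears on parity; no claim that a field with `h(−D) ≤ log D/(2 log log D)`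
exists beyond an effective bound. No instances, no notation, no axioms beyond the standard three.

## References

* [Pintz1976ElementaryIII] J. Pintz, Acta Arith. 31 (1976) 295–306: Theorem 1 p. 296 (1.3)–(1.6);
  Lemmas 1–3 p. 297 (2.1)–(2.4); proof of Theorem 1 p. 298; p. 297 lines 1–6 ("contained in [6]");
  standing assumption p. 296.
* [Pintz1976ElementaryII] J. Pintz, Acta Arith. 31 (1976) 273–289: Theorem 2 p. 276, §3 pp. 282–283
  (3.1)–(3.7); §2 (2.3), (2.8).
* [MontgomeryVaughan2007] §11.2.1 Exercise 3(g) (the form of II (2.3) used); §9.4 Thm. 9.18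
  (Pólya–Vinogradov).
-/

noncomputable section

open Complex Finset Filter Topology Metric

namespace Literature.NumberTheory.LFunctions

namespace Pintz1976Deuring

open Pintz1976 DirichletAbel

/-! ## Part L. (3.2)–(3.4) with the rate `1/log D`: the split primes `p ≤ √D/2` -/

section SplitPrimesRate

variable {K : Type*} [Field K] [NumberField K] {D : ℕ} [NeZero D]

/-- **Two small split primes cost `2a + 1` classes.** If `p ≠ p'` are primes with `χ(p) = χ(p') = 1`
and `p^a, p'^a ≤ √D/2`, then `2a + 1 ≤ h_K`: the `2a + 1` integers `1, p, …, p^a, p', …, p'^a` are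
`≤ √D/2` and composed of split primes, so they are first coefficients of distinct reduced forms
(the counting form (3.2) of Davenport's Hilfssatz, `card_le_classNumber_of_splitFactors`).
[cite: Pintz1976ElementaryII, §3 (3.2)–(3.3) p. 282] -/
theorem two_mul_add_one_le_classNumber (h2 : Module.finrank ℚ K = 2)
    (hd : NumberField.discr K < 0) (hKD : (NumberField.discr K).natAbs = D)
    {χ : DirichletCharacter ℂ D} (hprim : χ.IsPrimitive) (hquad : χ.IsQuadratic) (hodd : χ.Odd)
    {p p' : ℕ} (hp : p.Prime) (hp' : p'.Prime) (hne : p ≠ p') (hχp : χ (p : ZMod D) = 1)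
    (hχp' : χ (p' : ZMod D) = 1) {a : ℕ} (hpa : 4 * (p ^ a) ^ 2 ≤ D)
    (hpa' : 4 * (p' ^ a) ^ 2 ≤ D) :
    2 * a + 1 ≤ NumberField.classNumber K := by
  classical
  have hdisj : Disjoint ((Finset.range (a + 1)).image (fun i => p ^ i))
      ((Finset.range a).image (fun j => p' ^ (j + 1))) := by
    rw [Finset.disjoint_left]
    intro n hn hn'
    obtain ⟨i, -, rfl⟩ := Finset.mem_image.mp hn
    obtain ⟨j, -, hj⟩ := Finset.mem_image.mp hn'
    have h1 : p' ∣ p ^ i := by rw [← hj]; exact dvd_pow_self p' (Nat.succ_ne_zero j)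
    exact hne ((Nat.prime_dvd_prime_iff_eq hp' hp).mp (hp'.dvd_of_dvd_pow h1)).symm
  have hT := card_le_classNumber_of_splitFactors h2 hd hKD hprim hquad hodd
    ((Finset.range (a + 1)).image (fun i => p ^ i) ∪ (Finset.range a).image (fun j => p' ^ (j + 1)))
    ?_
  · rw [Finset.card_union_of_disjoint hdisj,
      Finset.card_image_of_injective _ (Nat.pow_right_injective hp.two_le),
      Finset.card_image_of_injOn, Finset.card_range, Finset.card_range] at hT
    · omega
    · intro x _ y _ hxy
      have := Nat.pow_right_injective hp'.two_le hxy
      omega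
  · intro n hn
    rcases Finset.mem_union.mp hn with hn | hn
    · obtain ⟨i, hi, rfl⟩ := Finset.mem_image.mp hn
      have hia : i ≤ a := Nat.lt_succ_iff.mp (Finset.mem_range.mp hi)
      refine ⟨pow_pos hp.pos i, ?_, fun q hq => ?_⟩
      · exact le_trans (Nat.mul_le_mul_left 4
          (Nat.pow_le_pow_left (Nat.pow_le_pow_right hp.pos hia) 2)) hpa
      · obtain ⟨hqp, hqdvd, -⟩ := Nat.mem_primeFactors.mp hq
        rw [(Nat.prime_dvd_prime_iff_eq hqp hp).mp (hqp.dvd_of_dvd_pow hqdvd)]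
        exact hχp
    · obtain ⟨j, hj, rfl⟩ := Finset.mem_image.mp hn
      have hja : j + 1 ≤ a := Finset.mem_range.mp hj
      refine ⟨pow_pos hp'.pos _, ?_, fun q hq => ?_⟩
      · exact le_trans (Nat.mul_le_mul_left 4
          (Nat.pow_le_pow_left (Nat.pow_le_pow_right hp'.pos hja) 2)) hpa'
      · obtain ⟨hqp, hqdvd, -⟩ := Nat.mem_primeFactors.mp hq
        rw [(Nat.prime_dvd_prime_iff_eq hqp hp').mp (hqp.dvd_of_dvd_pow hqdvd)]
        exact hχp'

omit [NeZero D] in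
/-- If `D < 4 (p^m)^2` (`m ≥ 1`) then `1/p < (4/D)^{1/(2m)}`. [folklore] -/
private theorem inv_lt_rpow_of_lt_four_mul_pow_sq (hD : 0 < D) {p m : ℕ} (hp : 0 < p) (hm : m ≠ 0)
    (hlt : D < 4 * (p ^ m) ^ 2) :
    1 / (p : ℝ) < (4 / (D : ℝ)) ^ (1 / (2 * (m : ℝ))) := by
  have hp0 : (0 : ℝ) < p := by exact_mod_cast hp
  have hD0 : (0 : ℝ) < D := by exact_mod_cast hD
  have hz : 0 < 1 / (2 * (m : ℝ)) := by
    have : (0 : ℝ) < m := by exact_mod_cast Nat.pos_of_ne_zero hm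
    positivity
  have hltr : (D : ℝ) / 4 < (p : ℝ) ^ (2 * m) := by
    have : (D : ℝ) < 4 * ((p : ℝ) ^ m) ^ 2 := by exact_mod_cast hlt
    rw [pow_mul']; linarith
  have h2m : 2 * m ≠ 0 := by omega
  have hexq : (1 : ℝ) / (2 * (m : ℝ)) = ((2 * m : ℕ) : ℝ)⁻¹ := by push_cast; ring
  have hroot : ((D : ℝ) / 4) ^ (1 / (2 * (m : ℝ))) < p := by
    have := Real.rpow_lt_rpow (by positivity) hltr hz
    rw [hexq, Real.pow_rpow_inv_natCast hp0.le h2m] at this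
    rwa [hexq]
  have hpos : 0 < ((D : ℝ) / 4) ^ (1 / (2 * (m : ℝ))) := Real.rpow_pos_of_pos (by positivity) _
  calc 1 / (p : ℝ) < 1 / ((D : ℝ) / 4) ^ (1 / (2 * (m : ℝ))) :=
        one_div_lt_one_div_of_lt hpos hroot
    _ = (4 / (D : ℝ)) ^ (1 / (2 * (m : ℝ))) := by
        rw [one_div, ← Real.inv_rpow (by positivity), inv_div]

/-- **(3.4) with the rate.** With `h = h_K`, for any set `P` of primes `p ≤ √D/2` with `χ(p) = 1`:
`Σ_{p ∈ P} 1/p ≤ (4/D)^{1/(2h)} + (h − 1)(4/D)^{1/(h+1)}`. (At most one `p ∈ P` has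
`p^{⌊(h+1)/2⌋} ≤ √D/2` by `two_mul_add_one_le_classNumber`; it contributes `< (4/D)^{1/(2h)}` by (3.3);
each of the `≤ h − 1` others has `p > (D/4)^{1/(2⌊(h+1)/2⌋)} ≥ (D/4)^{1/(h+1)}`.)
[cite: Pintz1976ElementaryII, §3 (3.2)–(3.4) p. 282] -/
theorem sum_inv_smallSplitPrimes_le_rate (h2 : Module.finrank ℚ K = 2)
    (hd : NumberField.discr K < 0) (hKD : (NumberField.discr K).natAbs = D)
    {χ : DirichletCharacter ℂ D} (hprim : χ.IsPrimitive) (hquad : χ.IsQuadratic) (hodd : χ.Odd)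
    (P : Finset ℕ) (hP : ∀ p ∈ P, p.Prime ∧ 4 * p ^ 2 ≤ D ∧ χ (p : ZMod D) = 1) :
    ∑ p ∈ P, 1 / (p : ℝ) ≤
      (4 / (D : ℝ)) ^ (1 / (2 * (NumberField.classNumber K : ℝ))) +
        ((NumberField.classNumber K : ℝ) - 1) *
          (4 / (D : ℝ)) ^ (1 / ((NumberField.classNumber K : ℝ) + 1)) := by
  classical
  set h := NumberField.classNumber K with hh_def
  have hh0 : 0 < h := NumberField.classNumber_pos K
  have hD0 : 0 < D := NeZero.pos D
  have hD0r : (0 : ℝ) < D := by exact_mod_cast hD0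
  set y₁ : ℝ := (4 / (D : ℝ)) ^ (1 / (2 * (h : ℝ))) with hy₁
  set y₂ : ℝ := (4 / (D : ℝ)) ^ (1 / ((h : ℝ) + 1)) with hy₂
  have hy₁0 : 0 ≤ y₁ := Real.rpow_nonneg (by positivity) _
  have hy₂0 : 0 ≤ y₂ := Real.rpow_nonneg (by positivity) _
  have hh1 : (1 : ℝ) ≤ h := by exact_mod_cast hh0
  -- trivial when `D < 4` (`P = ∅`)
  by_cases hD4 : D < 4
  · have hPe : P = ∅ := by
      rw [Finset.eq_empty_iff_forall_notMem]
      intro p hp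
      obtain ⟨hpp, hle, -⟩ := hP p hp
      have : 4 * 1 ≤ 4 * p ^ 2 := Nat.mul_le_mul_left 4 (Nat.one_le_pow _ _ hpp.pos)
      omega
    rw [hPe, Finset.sum_empty]
    nlinarith
  push Not at hD4
  have hbase1 : 4 / (D : ℝ) ≤ 1 := by
    rw [div_le_one hD0r]; exact_mod_cast hD4
  have hbase0 : 0 < 4 / (D : ℝ) := by positivity
  -- `a = ⌊(h+1)/2⌋`
  set a := (h + 1) / 2 with ha_def
  have ha1 : 1 ≤ a := by omega
  have h2a : 2 * a ≤ h + 1 := by omega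
  have hlt2a : h < 2 * a + 1 := by omega
  -- at most one `p ∈ P` with `p^a ≤ √D/2`
  set E := P.filter (fun p => 4 * (p ^ a) ^ 2 ≤ D) with hE_def
  have hE1 : E.card ≤ 1 := by
    refine Finset.card_le_one.mpr fun p hp p' hp' => ?_
    by_contra hne
    obtain ⟨hpP, hpa⟩ := Finset.mem_filter.mp hp
    obtain ⟨hp'P, hp'a⟩ := Finset.mem_filter.mp hp'
    obtain ⟨hpp, -, hχp⟩ := hP p hpP
    obtain ⟨hpp', -, hχp'⟩ := hP p' hp'P
    have := two_mul_add_one_le_classNumber h2 hd hKD hprim hquad hodd hpp hpp' hne hχp hχp'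
      hpa hp'a
    omega
  -- every `p ∈ P` has `1/p ≤ y₁`
  have hall : ∀ p ∈ P, 1 / (p : ℝ) ≤ y₁ := by
    intro p hp
    obtain ⟨hpp, -, hχ⟩ := hP p hp
    have hlt := lt_four_mul_pow_classNumber_sq h2 hd hKD hprim hquad hodd hpp hχ
    exact (inv_lt_rpow_of_lt_four_mul_pow_sq hD0 hpp.pos hh0.ne' hlt).le
  -- every `p ∈ P \ E` has `1/p ≤ y₂`
  have hrest : ∀ p ∈ P.filter (fun p => ¬ 4 * (p ^ a) ^ 2 ≤ D), 1 / (p : ℝ) ≤ y₂ := by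
    intro p hp
    obtain ⟨hpP, hpa⟩ := Finset.mem_filter.mp hp
    obtain ⟨hpp, -, -⟩ := hP p hpP
    push Not at hpa
    have h1 := inv_lt_rpow_of_lt_four_mul_pow_sq hD0 hpp.pos (by omega) hpa
    refine h1.le.trans ?_
    -- `(4/D)^{1/(2a)} ≤ (4/D)^{1/(h+1)}` as `2a ≤ h + 1` and `4/D ≤ 1`
    refine Real.rpow_le_rpow_of_exponent_ge hbase0 hbase1 ?_
    have h2ar : (2 : ℝ) * a ≤ h + 1 := by exact_mod_cast h2a
    have h1a : (1 : ℝ) ≤ a := by exact_mod_cast ha1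
    have ha0 : (0 : ℝ) < 2 * a := by linarith
    exact one_div_le_one_div_of_le ha0 h2ar
  have hy21 : y₂ ≤ y₁ := by
    refine Real.rpow_le_rpow_of_exponent_ge hbase0 hbase1 ?_
    exact one_div_le_one_div_of_le (by positivity) (by linarith)
  -- card bookkeeping
  have hcardP : P.card ≤ h := by
    refine card_le_classNumber_of_splitFactors h2 hd hKD hprim hquad hodd P fun p hp => ?_
    obtain ⟨hpp, hle, hχ⟩ := hP p hp
    refine ⟨hpp.pos, hle, fun q hq => ?_⟩
    obtain ⟨hqp, hqdvd, -⟩ := Nat.mem_primeFactors.mp hq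
    rw [(Nat.prime_dvd_prime_iff_eq hqp hpp).mp hqdvd]
    exact hχ
  have hsplit := Finset.sum_filter_add_sum_filter_not P (fun p => 4 * (p ^ a) ^ 2 ≤ D)
    (fun p => 1 / (p : ℝ))
  have hcards := Finset.card_filter_add_card_filter_not (s := P)
    (fun p => 4 * (p ^ a) ^ 2 ≤ D)
  rw [← hsplit]
  have hSE : ∑ p ∈ E, 1 / (p : ℝ) ≤ E.card • y₁ :=
    Finset.sum_le_card_nsmul _ _ _ fun p hp => hall p (Finset.mem_filter.mp hp).1
  have hSR : ∑ p ∈ P.filter (fun p => ¬ 4 * (p ^ a) ^ 2 ≤ D), 1 / (p : ℝ) ≤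
      (P.filter (fun p => ¬ 4 * (p ^ a) ^ 2 ≤ D)).card • y₂ :=
    Finset.sum_le_card_nsmul _ _ _ hrest
  rw [nsmul_eq_mul] at hSE hSR
  have hE1r : (E.card : ℝ) ≤ 1 := by exact_mod_cast hE1
  have hRr : ((P.filter (fun p => ¬ 4 * (p ^ a) ^ 2 ≤ D)).card : ℝ) ≤ h - E.card := by
    have : E.card + (P.filter (fun p => ¬ 4 * (p ^ a) ^ 2 ≤ D)).card ≤ h := by
      rw [hE_def, hcards]; exact hcardP
    have := (Nat.cast_le (α := ℝ)).mpr this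
    push_cast at this; linarith
  have hEc0 : (0 : ℝ) ≤ E.card := Nat.cast_nonneg _
  calc ∑ p ∈ E, 1 / (p : ℝ) + ∑ p ∈ P.filter (fun p => ¬ 4 * (p ^ a) ^ 2 ≤ D), 1 / (p : ℝ)
      ≤ E.card * y₁ + (h - E.card) * y₂ := by
        refine add_le_add hSE (hSR.trans ?_)
        exact mul_le_mul_of_nonneg_right hRr hy₂0
    _ = E.card * (y₁ - y₂) + h * y₂ := by ring
    _ ≤ 1 * (y₁ - y₂) + h * y₂ := by
        have := mul_le_mul_of_nonneg_right hE1r (sub_nonneg.mpr hy21)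
        linarith
    _ = y₁ + (h - 1) * y₂ := by ring

omit [NeZero D] in
/-- **The size of the bound.** For `x ≥ e^e` (so `log log x ≥ 1`) and `1 ≤ h ≤ log x/(2 log log x)`:
`(4/x)^{1/(2h)} + (h − 1)(4/x)^{1/(h+1)} ≤ (4 + exp(16 + 4 log 4)/2)/log x`.
(`(4/x)^{1/(2h)} ≤ 4/log x`; with `t = log x`, `u = log t ≤ 2√t`:
`(4/x)^{1/(h+1)} ≤ exp(−2u(t − log 4)/(t + 2u)) ≤ exp(−2u + (4u² + 2u log 4)/t) ≤ e^{16 + 4 log 4}/t²`,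
and `h ≤ t/(2u) ≤ t/2`.) [folklore] -/
private theorem smallSplit_rate_le {x h : ℝ} (hx : Real.exp (Real.exp 1) ≤ x) (h1 : 1 ≤ h)
    (hh : h ≤ Real.log x / (2 * Real.log (Real.log x))) :
    (4 / x) ^ (1 / (2 * h)) + (h - 1) * (4 / x) ^ (1 / (h + 1)) ≤
      (4 + Real.exp (16 + 4 * Real.log 4) / 2) / Real.log x := by
  have he1 : 1 ≤ Real.exp 1 := by have := Real.add_one_le_exp (1 : ℝ); linarith
  have hx1 : 1 < x := by
    have : Real.exp 1 ≤ Real.exp (Real.exp 1) := Real.exp_le_exp.mpr he1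
    have h1e : (1 : ℝ) < Real.exp 1 := by have := Real.add_one_le_exp (1 : ℝ); linarith
    linarith
  have hx0 : 0 < x := by linarith
  set t := Real.log x with ht
  have hte : Real.exp 1 ≤ t := by
    rw [ht, Real.le_log_iff_exp_le hx0]; exact hx
  have ht1 : 1 < t := by
    have h1e : (1 : ℝ) < Real.exp 1 := by have := Real.add_one_le_exp (1 : ℝ); linarith
    linarith
  have ht0 : 0 < t := by linarith
  set u := Real.log t with hu
  have hu1 : 1 ≤ u := by
    rw [hu, Real.le_log_iff_exp_le ht0]; exact hte
  have hu0 : 0 < u := by linarith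
  have hlog4 : 0 < Real.log 4 := Real.log_pos (by norm_num)
  have hlog4t : Real.log 4 ≤ t := by
    have : Real.log 4 ≤ Real.log (Real.exp (Real.exp 1)) := by
      refine Real.log_le_log (by norm_num) ?_
      -- `4 ≤ e^e`: `e ≥ 2.7`, `e^e ≥ e^2 ≥ (2.7)^2 > 4`
      have h27 : (2.7 : ℝ) < Real.exp 1 := lt_trans (by norm_num) Real.exp_one_gt_d9
      have : Real.exp 2 ≤ Real.exp (Real.exp 1) := Real.exp_le_exp.mpr (by linarith)
      have h2 : (4 : ℝ) ≤ Real.exp 2 := by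
        have := Real.add_one_le_exp (1 : ℝ)
        have h' : Real.exp 2 = Real.exp 1 * Real.exp 1 := by rw [← Real.exp_add]; norm_num
        rw [h']; nlinarith
      linarith
    rw [Real.log_exp] at this
    exact this.trans hte
  have hh0 : 0 < h := by linarith
  -- `h ≤ t/(2u)` unpacked
  have hhu : h * (2 * u) ≤ t := by
    have := hh; rwa [le_div_iff₀ (by positivity)] at this
  -- (i) the first term
  have hlog4x : Real.log (4 / x) = Real.log 4 - t := by
    rw [Real.log_div (by norm_num) hx0.ne']
  have hy1 : (4 / x) ^ (1 / (2 * h)) ≤ 4 / t := by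
    rw [Real.rpow_def_of_pos (by positivity), hlog4x]
    have hexp : (Real.log 4 - t) * (1 / (2 * h)) ≤ -u + Real.log 4 := by
      -- `(t - log 4)/(2h) ≥ (t - log 4) u/t ≥ u - log 4 · u/t ≥ u - log 4`
      have h1' : (t - Real.log 4) * u / t ≤ (t - Real.log 4) * (1 / (2 * h)) := by
        rw [div_le_iff₀ ht0]
        have : (t - Real.log 4) * u * (2 * h) ≤ (t - Real.log 4) * t := by
          have := mul_le_mul_of_nonneg_left hhu (by linarith : (0 : ℝ) ≤ t - Real.log 4)
          linarith [this]
        calc (t - Real.log 4) * u = (t - Real.log 4) * u * (2 * h) / (2 * h) := by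
              field_simp
          _ ≤ (t - Real.log 4) * t / (2 * h) := by
              exact div_le_div_of_nonneg_right this (by positivity)
          _ = (t - Real.log 4) * (1 / (2 * h)) * t := by ring
      have h2' : u - Real.log 4 ≤ (t - Real.log 4) * u / t := by
        rw [le_div_iff₀ ht0]
        have hut : u ≤ t := by
          rw [hu]; exact (Real.log_le_sub_one_of_pos ht0).trans (by linarith)
        nlinarith [mul_le_mul_of_nonneg_left hut hlog4.le]
      linarith
    calc Real.exp ((Real.log 4 - t) * (1 / (2 * h))) ≤ Real.exp (-u + Real.log 4) :=
          Real.exp_le_exp.mpr hexp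
      _ = 4 / t := by
          rw [Real.exp_add, Real.exp_log (by norm_num), Real.exp_neg, hu, Real.exp_log ht0]
          ring
  -- (ii) the second term
  have hK : (4 * u ^ 2 + 2 * u * Real.log 4) / t ≤ 16 + 4 * Real.log 4 := by
    have hu2 : u ≤ 2 * Real.sqrt t := by
      have := Real.log_le_rpow_div ht0.le (by norm_num : (0 : ℝ) < 1 / 2)
      rw [← Real.sqrt_eq_rpow] at this
      rw [hu]; linarith
    have hsq : Real.sqrt t ^ 2 = t := Real.sq_sqrt ht0.le
    have hst : Real.sqrt t ≤ t := by
      have hs1 : 1 ≤ Real.sqrt t := by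
        rw [show (1 : ℝ) = Real.sqrt 1 by simp]; exact Real.sqrt_le_sqrt ht1.le
      nlinarith
    rw [div_le_iff₀ ht0]
    have h1' : 4 * u ^ 2 ≤ 16 * t := by nlinarith [Real.sqrt_nonneg t]
    have h2' : 2 * u * Real.log 4 ≤ 4 * t * Real.log 4 := by nlinarith
    nlinarith
  have hy2 : (4 / x) ^ (1 / (h + 1)) ≤ Real.exp (16 + 4 * Real.log 4) / t ^ 2 := by
    rw [Real.rpow_def_of_pos (by positivity), hlog4x]
    -- `1/(h+1) ≥ 2u/(t + 2u)`
    have hh1' : (h + 1) * (2 * u) ≤ t + 2 * u := by nlinarith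
    have hexp : (Real.log 4 - t) * (1 / (h + 1)) ≤ -2 * u + (16 + 4 * Real.log 4) := by
      have hA : (Real.log 4 - t) * (1 / (h + 1)) ≤ (Real.log 4 - t) * (2 * u / (t + 2 * u)) := by
        -- both factors: `log 4 - t ≤ 0`, and `1/(h+1) ≥ 2u/(t+2u)`
        have hneg : Real.log 4 - t ≤ 0 := by linarith
        have hcmp : 2 * u / (t + 2 * u) ≤ 1 / (h + 1) := by
          rw [div_le_div_iff₀ (by positivity) (by positivity)]; linarith
        exact mul_le_mul_of_nonpos_left hcmp hneg
      have hB : (Real.log 4 - t) * (2 * u / (t + 2 * u)) =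
          -2 * u + 2 * u * (2 * u + Real.log 4) / (t + 2 * u) := by
        field_simp; ring
      have hC : 2 * u * (2 * u + Real.log 4) / (t + 2 * u) ≤
          (4 * u ^ 2 + 2 * u * Real.log 4) / t := by
        rw [div_le_div_iff₀ (by positivity) ht0]
        have : 0 ≤ (4 * u ^ 2 + 2 * u * Real.log 4) * (2 * u) := by positivity
        nlinarith
      linarith
    calc Real.exp ((Real.log 4 - t) * (1 / (h + 1)))
        ≤ Real.exp (-2 * u + (16 + 4 * Real.log 4)) := Real.exp_le_exp.mpr hexp
      _ = Real.exp (16 + 4 * Real.log 4) / t ^ 2 := by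
          rw [Real.exp_add, show -2 * u = -(2 * u) by ring, Real.exp_neg, hu,
            show 2 * Real.log t = Real.log (t ^ 2) by rw [Real.log_pow]; norm_num,
            Real.exp_log (by positivity)]
          ring
  -- `h - 1 ≤ h ≤ t/2`
  have hht : h ≤ t / 2 := by
    rw [le_div_iff₀ (by norm_num : (0 : ℝ) < 2)]; nlinarith
  have hpos2 : 0 ≤ Real.exp (16 + 4 * Real.log 4) / t ^ 2 := by positivity
  calc (4 / x) ^ (1 / (2 * h)) + (h - 1) * (4 / x) ^ (1 / (h + 1))
      ≤ 4 / t + (t / 2) * (Real.exp (16 + 4 * Real.log 4) / t ^ 2) := by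
        refine add_le_add hy1 ?_
        calc (h - 1) * (4 / x) ^ (1 / (h + 1)) ≤ (h - 1) * (Real.exp (16 + 4 * Real.log 4) / t ^ 2) :=
              mul_le_mul_of_nonneg_left hy2 (by linarith)
          _ ≤ (t / 2) * (Real.exp (16 + 4 * Real.log 4) / t ^ 2) :=
              mul_le_mul_of_nonneg_right (by linarith) hpos2
    _ = (4 + Real.exp (16 + 4 * Real.log 4) / 2) / t := by
        field_simp

end SplitPrimesRate


/-! ## Elementary inputs: `log^k x ≤ (k/a)^k x^a`, the `ζ(2)` tail, `⌊D^{1/4}⌋`, and the real bookkeeping -/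

section Elementary

/-- `(log x)^k ≤ (k/a)^k x^a` for `x ≥ 1`, `a > 0`, `k ≥ 1`. [folklore] -/
private theorem log_pow_le_rpow {x a : ℝ} (hx : 1 ≤ x) (ha : 0 < a) {k : ℕ} (hk : k ≠ 0) :
    Real.log x ^ k ≤ ((k : ℝ) / a) ^ k * x ^ a := by
  have hx0 : 0 ≤ x := by linarith
  have hk0 : (0 : ℝ) < k := by exact_mod_cast Nat.pos_of_ne_zero hk
  have h := Real.log_le_rpow_div hx0 (show 0 < a / k by positivity)
  have hlog0 : 0 ≤ Real.log x := Real.log_nonneg hx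
  have h' : Real.log x ≤ (k / a) * x ^ (a / k) := by
    rw [div_div_eq_mul_div] at h
    calc Real.log x ≤ x ^ (a / k) * k / a := h
      _ = (k / a) * x ^ (a / k) := by ring
  calc Real.log x ^ k ≤ ((k / a) * x ^ (a / k)) ^ k := pow_le_pow_left₀ hlog0 h' k
    _ = ((k : ℝ) / a) ^ k * (x ^ (a / k)) ^ k := mul_pow _ _ _
    _ = ((k : ℝ) / a) ^ k * x ^ a := by
        rw [← Real.rpow_natCast (x ^ (a / k)) k, ← Real.rpow_mul hx0]
        congr 2; field_simp

/-- The tail of `ζ(2)`: `π²/6 − 2/(N+1) ≤ Σ_{l ≤ N} 1/l²`. [folklore] -/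
private theorem pi_sq_div_six_sub_le_sum_inv_sq (N : ℕ) :
    Real.pi ^ 2 / 6 - 2 / ((N : ℝ) + 1) ≤ ∑ l ∈ Icc 1 N, 1 / (l : ℝ) ^ 2 := by
  have ht := hasSum_zeta_two.tendsto_sum_nat
  have hbound : ∀ᶠ M in atTop, ∑ i ∈ Finset.range M, 1 / (i : ℝ) ^ 2 ≤
      ∑ i ∈ Finset.range (N + 1), 1 / (i : ℝ) ^ 2 + 2 / ((N : ℝ) + 1) := by
    refine eventually_atTop.mpr ⟨N + 1, fun M hM => ?_⟩
    rw [← Finset.sum_range_add_sum_Ico _ hM]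
    have hIco : Finset.Ico (N + 1) M = Finset.Ioo N M := by
      ext i; simp only [Finset.mem_Ico, Finset.mem_Ioo]; omega
    have h := sum_Ioo_inv_sq_le (α := ℝ) N M
    have : ∑ i ∈ Finset.Ico (N + 1) M, 1 / (i : ℝ) ^ 2 ≤ 2 / ((N : ℝ) + 1) := by
      rw [hIco]; simpa [one_div] using h
    linarith
  have hle : Real.pi ^ 2 / 6 ≤ ∑ i ∈ Finset.range (N + 1), 1 / (i : ℝ) ^ 2 + 2 / ((N : ℝ) + 1) :=
    le_of_tendsto ht hbound
  have hre : ∑ i ∈ Finset.range (N + 1), 1 / (i : ℝ) ^ 2 = ∑ l ∈ Icc 1 N, 1 / (l : ℝ) ^ 2 := by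
    rw [Finset.range_eq_Ico, Finset.sum_eq_sum_Ico_succ_bot (Nat.succ_pos N)]
    have hIcc : Finset.Ico 1 (N + 1) = Finset.Icc 1 N := by
      ext i; simp only [Finset.mem_Ico, Finset.mem_Icc]; omega
    rw [hIcc]; simp
  linarith

/-- `r = ⌊√⌊√D⌋⌋ ≥ 1`: `r⁴ ≤ D < 16 r⁴`. [folklore] -/
private theorem fourthRoot_facts {D : ℕ} (hr : 1 ≤ Nat.sqrt (Nat.sqrt D)) :
    ((Nat.sqrt (Nat.sqrt D) : ℝ)) ^ 4 ≤ D ∧ (D : ℝ) < 16 * (Nat.sqrt (Nat.sqrt D) : ℝ) ^ 4 := by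
  set s := Nat.sqrt D with hs
  set r := Nat.sqrt s with hrdef
  have hr2 : r ^ 2 ≤ s := Nat.sqrt_le' s
  have hs2 : s ^ 2 ≤ D := Nat.sqrt_le' D
  have hslt : D < (s + 1) ^ 2 := Nat.lt_succ_sqrt' D
  have hrlt : s < (r + 1) ^ 2 := Nat.lt_succ_sqrt' s
  have hr4 : r ^ 4 ≤ D := by
    calc r ^ 4 = (r ^ 2) ^ 2 := by ring
      _ ≤ s ^ 2 := Nat.pow_le_pow_left hr2 2
      _ ≤ D := hs2
  have hD16 : D < 16 * r ^ 4 := by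
    have h1 : s + 1 ≤ (r + 1) ^ 2 := hrlt
    have h2 : D < ((r + 1) ^ 2) ^ 2 := lt_of_lt_of_le hslt (Nat.pow_le_pow_left h1 2)
    have h3 : (r + 1) ^ 2 ≤ (2 * r) ^ 2 := Nat.pow_le_pow_left (by omega) 2
    calc D < ((r + 1) ^ 2) ^ 2 := h2
      _ ≤ ((2 * r) ^ 2) ^ 2 := Nat.pow_le_pow_left h3 2
      _ = 16 * r ^ 4 := by ring
  exact ⟨by exact_mod_cast hr4, by exact_mod_cast hD16⟩

/-- **The real bookkeeping of Lemma 1.** With `Z = P·π²/6` (`P ≥ 1`), from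
`|S − L'(1) − M| ≤ E₁` (`M ≥ 0`), `P(π²/6 − ν) ≤ S ≤ e^{4σ} Z` and `E₁, M, ν, σ ≤ A r`, `16 A r ≤ 1`:
`|L'(1)/Z − 1| ≤ 11 A r` and `L'(1) > 1`. [folklore] -/
private theorem lemma1_real {P S L M E₁ ν σ A r : ℝ} (hP : 1 ≤ P) (hM0 : 0 ≤ M) (hσ0 : 0 ≤ σ)
    (hr : 0 ≤ r) (hA : 0 ≤ A) (hE : |S - L - M| ≤ E₁) (hB : P * (Real.pi ^ 2 / 6 - ν) ≤ S)
    (hJ : S ≤ Real.exp (4 * σ) * (Real.pi ^ 2 / 6 * P)) (hE₁ : E₁ ≤ A * r) (hMr : M ≤ A * r)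
    (hνr : ν ≤ A * r) (hσr : σ ≤ A * r) (h16 : 16 * A * r ≤ 1) :
    |L / (P * (Real.pi ^ 2 / 6)) - 1| ≤ 11 * A * r ∧ 1 < L := by
  have hπ3 : 3 < Real.pi := Real.pi_gt_three
  have hπ6 : 1 ≤ Real.pi ^ 2 / 6 := by
    have : (9 : ℝ) < Real.pi ^ 2 := by nlinarith only [hπ3]
    linarith only [this]
  set Z := P * (Real.pi ^ 2 / 6) with hZ
  have hZP : P ≤ Z := by
    have := mul_le_mul_of_nonneg_left hπ6 (by linarith : (0 : ℝ) ≤ P)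
    rw [mul_one] at this; exact this
  have hZ1 : 1 ≤ Z := hP.trans hZP
  have hZ0 : 0 < Z := by linarith
  have hAr : 0 ≤ A * r := mul_nonneg hA hr
  -- `e^{4σ} ≤ 1 + 8σ`
  have hexp : Real.exp (4 * σ) ≤ 1 + 8 * σ := by
    have h4 : |4 * σ| ≤ 1 := by rw [abs_of_nonneg (by positivity)]; nlinarith
    have h' := Real.abs_exp_sub_one_le h4
    rw [abs_of_nonneg (by positivity : (0 : ℝ) ≤ 4 * σ)] at h'
    have := (abs_le.mp h').2
    linarith only [this]
  have hSup : S ≤ Z + 8 * (A * r) * Z := by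
    have h1 : Real.exp (4 * σ) * (Real.pi ^ 2 / 6 * P) ≤ (1 + 8 * σ) * (Real.pi ^ 2 / 6 * P) :=
      mul_le_mul_of_nonneg_right hexp (by positivity)
    have h2 : (1 + 8 * σ) * (Real.pi ^ 2 / 6 * P) ≤ (1 + 8 * (A * r)) * (Real.pi ^ 2 / 6 * P) :=
      mul_le_mul_of_nonneg_right (by linarith) (by positivity)
    have h3 : (1 + 8 * (A * r)) * (Real.pi ^ 2 / 6 * P) = Z + 8 * (A * r) * Z := by rw [hZ]; ring
    linarith
  have hSlow : Z - P * (A * r) ≤ S := by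
    have h1 : P * ν ≤ P * (A * r) := mul_le_mul_of_nonneg_left hνr (by linarith)
    have h2 : P * (Real.pi ^ 2 / 6 - ν) = Z - P * ν := by rw [hZ]; ring
    linarith
  have hE' := abs_le.mp hE
  have hup : L ≤ Z + 8 * (A * r) * Z + A * r := by linarith [hE'.1]
  have hlow : Z - P * (A * r) - 2 * (A * r) ≤ L := by linarith [hE'.2]
  have hPAr : P * (A * r) ≤ Z * (A * r) := mul_le_mul_of_nonneg_right hZP hAr
  have hArZ : A * r ≤ Z * (A * r) := by
    have := mul_le_mul_of_nonneg_right hZ1 hAr; rwa [one_mul] at this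
  have habs : |L - Z| ≤ 11 * (A * r) * Z := by
    rw [abs_le]; constructor <;> nlinarith
  constructor
  · have hid : L / Z - 1 = (L - Z) / Z := by field_simp
    rw [hid, abs_div, abs_of_pos hZ0, div_le_iff₀ hZ0]
    calc |L - Z| ≤ 11 * (A * r) * Z := habs
      _ = 11 * A * r * Z := by ring
  · -- `L ≥ Z − 3 A r Z ≥ Z(1 − 3/16) ≥ 13/16 · 3/2 > 1`
    have h1 : Z - 3 * (A * r) * Z ≤ L := by nlinarith
    have h2 : 3 * (A * r) * Z ≤ (3 / 16) * Z := by
      have : 3 * (A * r) ≤ 3 / 16 := by nlinarith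
      exact mul_le_mul_of_nonneg_right this hZ0.le
    have hZ32 : 3 / 2 ≤ Z := by
      have : (3 / 2 : ℝ) ≤ Real.pi ^ 2 / 6 := by nlinarith only [hπ3]
      calc (3 / 2 : ℝ) ≤ 1 * (Real.pi ^ 2 / 6) := by linarith
        _ ≤ P * (Real.pi ^ 2 / 6) := mul_le_mul_of_nonneg_right hP (by positivity)
    linarith

end Elementary


/-! ## Part M. The power-saving error terms and the assembly of Lemma 1 -/

section Bounds

/-- `e < 3`, so `log x ≥ 1` for `x ≥ 3`. [folklore] -/
private theorem one_le_log_of_three_le {x : ℝ} (hx : 3 ≤ x) : 1 ≤ Real.log x := by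
  rw [Real.le_log_iff_exp_le (by linarith)]
  exact le_trans (le_of_lt (lt_trans Real.exp_one_lt_d9 (by norm_num))) hx

/-- `log²x/√x ≤ 216/log x` for `x ≥ 3` (from `log³x ≤ 6³ √x`). [folklore] -/
private theorem log_sq_div_sqrt_le {x : ℝ} (hx : 3 ≤ x) : Real.log x ^ 2 / Real.sqrt x ≤ 216 / Real.log x := by
  have hx1 : 1 ≤ x := by linarith
  have hlog := one_le_log_of_three_le hx
  have hsqrt : 0 < Real.sqrt x := Real.sqrt_pos.mpr (by linarith)
  have h := log_pow_le_rpow hx1 (show (0 : ℝ) < 1 / 2 by norm_num) (k := 3) (by norm_num)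
  rw [← Real.sqrt_eq_rpow] at h
  norm_num at h
  rw [div_le_div_iff₀ hsqrt (by linarith)]
  nlinarith

/-- `log²x/√x ≤ 4096/log²x` for `x ≥ 3` (from `log⁴x ≤ 8⁴ √x`). [folklore] -/
private theorem log_sq_div_sqrt_le' {x : ℝ} (hx : 3 ≤ x) :
    Real.log x ^ 2 / Real.sqrt x ≤ 4096 / Real.log x ^ 2 := by
  have hx1 : 1 ≤ x := by linarith
  have hlog := one_le_log_of_three_le hx
  have hsqrt : 0 < Real.sqrt x := Real.sqrt_pos.mpr (by linarith)
  have h := log_pow_le_rpow hx1 (show (0 : ℝ) < 1 / 2 by norm_num) (k := 4) (by norm_num)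
  rw [← Real.sqrt_eq_rpow] at h
  norm_num at h
  rw [div_le_div_iff₀ hsqrt (by positivity)]
  nlinarith

/-- `log²x/x^{1/4} ≤ 65536/log²x` for `x ≥ 3` (from `log⁴x ≤ 16⁴ x^{1/4}`). [folklore] -/
private theorem log_sq_div_fourthRoot_le {x : ℝ} (hx : 3 ≤ x) :
    Real.log x ^ 2 / x ^ (1 / 4 : ℝ) ≤ 65536 / Real.log x ^ 2 := by
  have hx1 : 1 ≤ x := by linarith
  have hlog := one_le_log_of_three_le hx
  have h4 : 0 < x ^ (1 / 4 : ℝ) := Real.rpow_pos_of_pos (by linarith) _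
  have h := log_pow_le_rpow hx1 (show (0 : ℝ) < 1 / 4 by norm_num) (k := 4) (by norm_num)
  norm_num at h
  rw [div_le_div_iff₀ h4 (by positivity)]
  nlinarith

/-- **(2.3) error.** For `D ≥ 3`: `8√D(1+log D)(2 log D+1)/(D+1) + 4/D ≤ 10372/log D`. [folklore] -/
private theorem lemmaOne_error_le {x : ℝ} (hx : 3 ≤ x) :
    8 * (Real.sqrt x * (1 + Real.log x)) * (2 * Real.log x + 1) / (x + 1) + 4 / x ≤
      10372 / Real.log x := by
  have hx0 : 0 < x := by linarith
  have hlog := one_le_log_of_three_le hx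
  have hsqrt : 0 < Real.sqrt x := Real.sqrt_pos.mpr hx0
  have hsq : Real.sqrt x * Real.sqrt x = x := Real.mul_self_sqrt hx0.le
  -- `√x/(x+1) ≤ 1/√x`
  have hfrac : Real.sqrt x / (x + 1) ≤ 1 / Real.sqrt x := by
    rw [div_le_div_iff₀ (by linarith) hsqrt]; nlinarith
  have h1 : 8 * (Real.sqrt x * (1 + Real.log x)) * (2 * Real.log x + 1) / (x + 1) ≤
      48 * (Real.log x ^ 2 / Real.sqrt x) := by
    have hA : (1 + Real.log x) * (2 * Real.log x + 1) ≤ (2 * Real.log x) * (3 * Real.log x) :=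
      mul_le_mul (by linarith) (by linarith) (by linarith) (by linarith)
    calc 8 * (Real.sqrt x * (1 + Real.log x)) * (2 * Real.log x + 1) / (x + 1)
        = 8 * ((1 + Real.log x) * (2 * Real.log x + 1)) * (Real.sqrt x / (x + 1)) := by ring
      _ ≤ 8 * ((2 * Real.log x) * (3 * Real.log x)) * (1 / Real.sqrt x) :=
          mul_le_mul (mul_le_mul_of_nonneg_left hA (by norm_num)) hfrac (by positivity)
            (by positivity)
      _ = 48 * (Real.log x ^ 2 / Real.sqrt x) := by ring
  have h2 : 4 / x ≤ 4 / Real.log x :=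
    div_le_div_of_nonneg_left (by norm_num) (by linarith)
      ((Real.log_le_sub_one_of_pos hx0).trans (by linarith))
  have h3 := log_sq_div_sqrt_le hx
  calc _ ≤ 48 * (216 / Real.log x) + 4 / Real.log x := by linarith [mul_le_mul_of_nonneg_left h3 (by norm_num : (0:ℝ) ≤ 48)]
    _ = 10372 / Real.log x := by ring

/-- **The `(2 log D + γ)L(1)` term.** For `D ≥ 3` with `log log D ≥ 1` and `1 ≤ h ≤ log D/(2 log log D)`:
`(2 log D + γ) π h/√D ≤ 1296/log D`. [folklore] -/
private theorem logTerm_le {x h : ℝ} (hx : 3 ≤ x) (hLL : 1 ≤ Real.log (Real.log x)) (h0 : 0 ≤ h)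
    (hh : h ≤ Real.log x / (2 * Real.log (Real.log x))) :
    (2 * Real.log x + Real.eulerMascheroniConstant) * (Real.pi * h / Real.sqrt x) ≤
      1296 / Real.log x := by
  have hx0 : 0 < x := by linarith
  have hlog := one_le_log_of_three_le hx
  have hsqrt : 0 < Real.sqrt x := Real.sqrt_pos.mpr hx0
  have hγ : Real.eulerMascheroniConstant ≤ 1 :=
    (Real.eulerMascheroniConstant_lt_two_thirds.trans (by norm_num)).le
  have hπ4 : Real.pi ≤ 4 := Real.pi_le_four
  have hh2 : h ≤ Real.log x / 2 := by
    refine hh.trans ?_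
    rw [div_le_div_iff₀ (by positivity) (by norm_num)]
    nlinarith
  have hnum : (2 * Real.log x + Real.eulerMascheroniConstant) * (Real.pi * h) ≤
      6 * Real.log x ^ 2 := by
    have ha : 2 * Real.log x + Real.eulerMascheroniConstant ≤ 3 * Real.log x := by linarith
    have hb : Real.pi * h ≤ 4 * (Real.log x / 2) :=
      mul_le_mul hπ4 hh2 h0 (by norm_num)
    calc (2 * Real.log x + Real.eulerMascheroniConstant) * (Real.pi * h)
        ≤ (3 * Real.log x) * (4 * (Real.log x / 2)) :=
          mul_le_mul ha hb (by positivity) (by positivity)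
      _ = 6 * Real.log x ^ 2 := by ring
  have h3 := log_sq_div_sqrt_le hx
  calc (2 * Real.log x + Real.eulerMascheroniConstant) * (Real.pi * h / Real.sqrt x)
      = (2 * Real.log x + Real.eulerMascheroniConstant) * (Real.pi * h) / Real.sqrt x := by ring
    _ ≤ 6 * Real.log x ^ 2 / Real.sqrt x := div_le_div_of_nonneg_right hnum hsqrt.le
    _ = 6 * (Real.log x ^ 2 / Real.sqrt x) := by ring
    _ ≤ 6 * (216 / Real.log x) := mul_le_mul_of_nonneg_left h3 (by norm_num)
    _ = 1296 / Real.log x := by ring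

/-- **The `ζ(2)` tail term.** For `D ≥ 3`: `2/(⌊√D⌋ + 1) ≤ 4/log D`. [folklore] -/
private theorem zetaTwoTail_le {D : ℕ} (hD : 3 ≤ D) :
    2 / ((Nat.sqrt D : ℝ) + 1) ≤ 4 / Real.log D := by
  have hD3 : (3 : ℝ) ≤ D := by exact_mod_cast hD
  have hD0 : (0 : ℝ) < D := by linarith
  have hlog := one_le_log_of_three_le hD3
  have hsqrt : 0 < Real.sqrt D := Real.sqrt_pos.mpr hD0
  -- `√D < ⌊√D⌋ + 1`
  have hlt : Real.sqrt D < (Nat.sqrt D : ℝ) + 1 := by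
    have h := Nat.lt_succ_sqrt' D
    have h' : (D : ℝ) < ((Nat.sqrt D : ℝ) + 1) ^ 2 := by exact_mod_cast h
    calc Real.sqrt D < Real.sqrt (((Nat.sqrt D : ℝ) + 1) ^ 2) :=
          Real.sqrt_lt_sqrt hD0.le h'
      _ = (Nat.sqrt D : ℝ) + 1 := Real.sqrt_sq (by positivity)
  -- `log D ≤ 2√D`
  have hl2 : Real.log D ≤ 2 * Real.sqrt D := by
    have := Real.log_le_rpow_div hD0.le (by norm_num : (0 : ℝ) < 1 / 2)
    rw [← Real.sqrt_eq_rpow] at this; linarith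
  calc 2 / ((Nat.sqrt D : ℝ) + 1) ≤ 2 / Real.sqrt D :=
        div_le_div_of_nonneg_left (by norm_num) hsqrt hlt.le
    _ ≤ 4 / Real.log D := by
        rw [div_le_div_iff₀ hsqrt (by linarith)]; linarith

/-- **(3.5) term, explicit.** For `D ≥ 256` with `log log D ≥ 1`, `1 ≤ h ≤ log D/(2 log log D)` and
`r = ⌊√⌊√D⌋⌋`: `4 (π h/√D) log D + 3556(1 + log r)²/r ≤ 10797²/log²D`. [folklore] -/
private theorem splitBig_sq_le {D : ℕ} (hD : 256 ≤ D) {h : ℝ} (hLL : 1 ≤ Real.log (Real.log D))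
    (h0 : 0 ≤ h) (hh : h ≤ Real.log D / (2 * Real.log (Real.log D))) :
    4 * (Real.pi * h / Real.sqrt D) * Real.log D +
        3556 * (1 + Real.log (Nat.sqrt (Nat.sqrt D))) ^ 2 / (Nat.sqrt (Nat.sqrt D)) ≤
      (10797 / Real.log D) ^ 2 := by
  have hD3 : (3 : ℝ) ≤ D := by exact_mod_cast (le_trans (by norm_num) hD)
  have hD0 : (0 : ℝ) < D := by linarith
  have hlog1 := one_le_log_of_three_le hD3
  have hsqrt : 0 < Real.sqrt D := Real.sqrt_pos.mpr hD0
  have hπ4 : Real.pi ≤ 4 := Real.pi_le_four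
  -- `log D ≥ 4`
  have hlog4 : 4 ≤ Real.log D := by
    rw [Real.le_log_iff_exp_le hD0]
    have he : Real.exp 1 ^ 4 = Real.exp 4 := by rw [Real.exp_one_pow]; norm_cast
    have h27 := Real.exp_one_lt_d9
    have hpos := Real.exp_pos 1
    have h2 : Real.exp 1 * Real.exp 1 < 7.39 := by nlinarith
    have h4 : (Real.exp 1 * Real.exp 1) * (Real.exp 1 * Real.exp 1) < 55 := by
      nlinarith [mul_pos hpos hpos]
    have : Real.exp 1 ^ 4 < 256 := by nlinarith
    calc Real.exp 4 ≤ 256 := by rw [← he]; exact this.le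
      _ ≤ D := by exact_mod_cast hD
  have hh2 : h ≤ Real.log D / 2 := by
    refine hh.trans ?_
    rw [div_le_div_iff₀ (by positivity) (by norm_num)]
    nlinarith
  -- first term `≤ 8 log²D/√D ≤ 32768/log²D`
  have h1 : 4 * (Real.pi * h / Real.sqrt D) * Real.log D ≤ 32768 / Real.log D ^ 2 := by
    have hnum : Real.pi * h ≤ 4 * (Real.log D / 2) := mul_le_mul hπ4 hh2 h0 (by norm_num)
    have h3 := log_sq_div_sqrt_le' hD3
    calc 4 * (Real.pi * h / Real.sqrt D) * Real.log D = 4 * (Real.pi * h) * Real.log D / Real.sqrt D := by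
          ring
      _ ≤ 4 * (4 * (Real.log D / 2)) * Real.log D / Real.sqrt D := by
          gcongr
      _ = 8 * (Real.log D ^ 2 / Real.sqrt D) := by ring
      _ ≤ 8 * (4096 / Real.log D ^ 2) := mul_le_mul_of_nonneg_left h3 (by norm_num)
      _ = 32768 / Real.log D ^ 2 := by ring
  -- the fourth root `r`
  set r := Nat.sqrt (Nat.sqrt D) with hr_def
  have hr4 : 4 ≤ r := by
    rw [hr_def, Nat.le_sqrt', Nat.le_sqrt']; exact le_trans (by norm_num) hD
  have hr1 : 1 ≤ r := le_trans (by norm_num) hr4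
  obtain ⟨hrD, hDr⟩ := fourthRoot_facts (D := D) hr1
  have hr0 : (0 : ℝ) < r := by exact_mod_cast (lt_of_lt_of_le (by norm_num) hr1)
  have hr1r : (1 : ℝ) ≤ r := by exact_mod_cast hr1
  -- `log r ≤ log D/4`
  have hlogr : Real.log r ≤ Real.log D / 4 := by
    have : Real.log ((r : ℝ) ^ 4) ≤ Real.log D := Real.log_le_log (by positivity) hrD
    rw [Real.log_pow] at this; push_cast at this; linarith
  have hlogr0 : 0 ≤ Real.log r := Real.log_nonneg hr1r
  -- `D^{1/4} ≤ 2r`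
  have hroot : (D : ℝ) ^ (1 / 4 : ℝ) ≤ 2 * r := by
    have h' : (D : ℝ) ^ (1 / 4 : ℝ) ≤ (16 * (r : ℝ) ^ 4) ^ (1 / 4 : ℝ) :=
      Real.rpow_le_rpow hD0.le hDr.le (by norm_num)
    have h'' : (16 * (r : ℝ) ^ 4) ^ (1 / 4 : ℝ) = 2 * r := by
      rw [show (16 : ℝ) * (r : ℝ) ^ 4 = (2 * r) ^ 4 by ring,
        show (1 / 4 : ℝ) = ((4 : ℕ) : ℝ)⁻¹ by norm_num,
        Real.pow_rpow_inv_natCast (by positivity) (by norm_num)]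
    rw [h''] at h'; exact h'
  have hroot0 : 0 < (D : ℝ) ^ (1 / 4 : ℝ) := Real.rpow_pos_of_pos hD0 _
  have h2 : 3556 * (1 + Real.log r) ^ 2 / r ≤ 116523008 / Real.log D ^ 2 := by
    have ha : (1 + Real.log r) ^ 2 ≤ (Real.log D / 2) ^ 2 :=
      pow_le_pow_left₀ (by positivity) (by linarith) 2
    have hb : 1 / (r : ℝ) ≤ 2 / (D : ℝ) ^ (1 / 4 : ℝ) := by
      rw [div_le_div_iff₀ hr0 hroot0]; linarith
    have h3 := log_sq_div_fourthRoot_le hD3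
    calc 3556 * (1 + Real.log r) ^ 2 / r = 3556 * (1 + Real.log r) ^ 2 * (1 / r) := by ring
      _ ≤ 3556 * (Real.log D / 2) ^ 2 * (2 / (D : ℝ) ^ (1 / 4 : ℝ)) :=
          mul_le_mul (mul_le_mul_of_nonneg_left ha (by norm_num)) hb (by positivity) (by positivity)
      _ = 1778 * (Real.log D ^ 2 / (D : ℝ) ^ (1 / 4 : ℝ)) := by ring
      _ ≤ 1778 * (65536 / Real.log D ^ 2) := mul_le_mul_of_nonneg_left h3 (by norm_num)
      _ = 116523008 / Real.log D ^ 2 := by ring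
  have hlog0 : 0 < Real.log D := by linarith
  calc _ ≤ 32768 / Real.log D ^ 2 + 116523008 / Real.log D ^ 2 := add_le_add h1 h2
    _ = 116555776 / Real.log D ^ 2 := by ring
    _ ≤ (10797 / Real.log D) ^ 2 := by
        rw [div_pow, div_le_div_iff₀ (by positivity) (by positivity)]
        nlinarith [pow_pos hlog0 2]

end Bounds

section LemmaOneAssembly

open Literature.NumberTheory.QuadraticFields

/-- **Lemma 1 with the modulus as a separate variable** (`D = |d_K|`, `χ` the odd real primitive
character mod `D`): under `h_K ≤ log D/(2 log log D)` and `D > D₁`,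
`|L'(1)/(∏_{p∣D}(1+1/p) π²/6) − 1| ≤ C/log D` and `L'(1) > 1`.
[cite: Pintz1976ElementaryIII, Lemma 1 p. 297 (2.1)] -/
theorem lemma1_aux :
    ∃ C : ℝ, ∃ D₁ : ℕ, ∀ (D : ℕ) [NeZero D] (K : Type) [Field K] [NumberField K],
      Module.finrank ℚ K = 2 → NumberField.discr K < 0 → (NumberField.discr K).natAbs = D →
      D₁ < D →
      (NumberField.classNumber K : ℝ) ≤ Real.log D / (2 * Real.log (Real.log D)) →
      ∀ χ : DirichletCharacter ℂ D, χ.IsQuadratic → χ.IsPrimitive → χ.Odd →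
        |(deriv χ.LFunction 1).re / (eulerFactor D * (Real.pi ^ 2 / 6)) - 1| ≤ C / Real.log D ∧
          1 < (deriv χ.LFunction 1).re := by
  obtain ⟨A, hA_def⟩ : ∃ A : ℝ,
      A = 10372 + 1296 + 4 + 10797 + (4 + Real.exp (16 + 4 * Real.log 4) / 2) := ⟨_, rfl⟩
  have hA0 : 0 ≤ A := by rw [hA_def]; positivity
  refine ⟨11 * A, max (max 256 ⌈Real.exp (Real.exp 1)⌉₊) ⌈Real.exp (16 * A)⌉₊, ?_⟩
  intro D _ K _ _ h2 hd hKD hD1 hh χ hquad hprim hodd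
  classical
  -- thresholds
  have hD1' := hD1.le
  have hD256 : 256 ≤ D := le_trans (le_trans (le_max_left _ _) (le_max_left _ _)) hD1'
  have hDee : ⌈Real.exp (Real.exp 1)⌉₊ ≤ D :=
    le_trans (le_trans (le_max_right _ _) (le_max_left _ _)) hD1'
  have hDA : ⌈Real.exp (16 * A)⌉₊ ≤ D := le_trans (le_max_right _ _) hD1'
  have hD3 : 3 ≤ D := le_trans (by norm_num) hD256
  have hD2 : 2 ≤ D := le_trans (by norm_num) hD256
  have hD3r : (3 : ℝ) ≤ D := by exact_mod_cast hD3
  have hD0r : (0 : ℝ) < D := by linarith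
  have hlog1 : 1 ≤ Real.log D := one_le_log_of_three_le hD3r
  have hlog0 : 0 < Real.log D := by linarith
  have hDeer : Real.exp (Real.exp 1) ≤ D := le_trans (Nat.le_ceil _) (by exact_mod_cast hDee)
  have hLL : 1 ≤ Real.log (Real.log D) := by
    have h1 : Real.exp 1 ≤ Real.log D := by rw [Real.le_log_iff_exp_le hD0r]; exact hDeer
    rw [Real.le_log_iff_exp_le hlog0]; exact h1
  have h16A : 16 * A ≤ Real.log D := by
    have h1 : Real.exp (16 * A) ≤ D := le_trans (Nat.le_ceil _) (by exact_mod_cast hDA)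
    rw [Real.le_log_iff_exp_le hD0r]; exact h1
  -- the character, the class number formula `L(1) = π h/√D`
  have hq : χ ^ 2 = 1 := MulChar.IsQuadratic.sq_eq_one hquad
  have hΔ : NumberField.discr K = -(D : ℤ) := by rw [← hKD]; omega
  have hne : χ ≠ 1 := by
    intro h1
    have h := hodd
    rw [DirichletCharacter.Odd, h1, MulChar.one_apply isUnit_one.neg] at h
    norm_num at h
  have hd4 : NumberField.discr K < -4 := by omega
  have hcnf := Quadratic.LFunction_one_eq_of_discr_neg_of_eq h2 hd hne (fun s hs => by
    rw [← DirichletCharacter.LFunction_eq_LSeries χ (show 1 < (s : ℂ).re by simpa using hs)]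
    exact Quadratic.dedekindZeta_eq_riemannZeta_mul_LFunction_of_odd_primitive hprim hquad hodd
      h2 hΔ (by simpa using hs))
  have hw : (NumberField.Units.torsionOrder K : ℝ) = 2 := by
    exact_mod_cast Quadratic.torsionOrder_eq_two_of_discr_lt_neg_four h2 hd4
  have habs : |(NumberField.discr K : ℝ)| = (D : ℝ) := by
    rw [← hKD, Nat.cast_natAbs, Int.cast_abs]
  obtain ⟨h, hh_def⟩ : ∃ h : ℝ, h = (NumberField.classNumber K : ℝ) := ⟨_, rfl⟩
  rw [← hh_def] at hh
  have hh1 : 1 ≤ h := by rw [hh_def]; exact_mod_cast NumberField.classNumber_pos K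
  have hh0 : 0 ≤ h := by linarith
  have hsqrtD : 0 < Real.sqrt D := Real.sqrt_pos.2 hD0r
  have hπ := Real.pi_pos
  have hL1 : (χ.LFunction 1).re = Real.pi * h / Real.sqrt D := by
    rw [hcnf, Complex.ofReal_re, hw, habs, hh_def, mul_assoc,
      mul_div_mul_left _ _ (two_ne_zero' ℝ)]
  -- the objects
  obtain ⟨P, hP_def⟩ : ∃ P : ℝ, P = ∏ p ∈ D.primeFactors, (1 + 1 / (p : ℝ)) := ⟨_, rfl⟩
  have hPe : eulerFactor D = P := by rw [hP_def, eulerFactor]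
  obtain ⟨S, hS_def⟩ : ∃ S : ℝ, S = gSum χ ((D : ℝ) ^ 2) := ⟨_, rfl⟩
  have hP1 : 1 ≤ P := by
    rw [hP_def]
    calc (1 : ℝ) = ∏ _p ∈ D.primeFactors, (1 : ℝ) := by simp
      _ ≤ ∏ p ∈ D.primeFactors, (1 + 1 / (p : ℝ)) :=
          prod_le_prod (fun _ _ => zero_le_one) fun p _ => by
            have : (0 : ℝ) ≤ 1 / (p : ℝ) := by positivity
            linarith
  -- (E): (2.3)
  have hE := abs_gSum_sq_sub_le χ hprim hD2
  rw [← hS_def, hL1] at hE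
  -- (B): (2.8) and the `ζ(2)` tail
  have hB : P * (Real.pi ^ 2 / 6 - 2 / ((Nat.sqrt D : ℝ) + 1)) ≤ S := by
    have h1 := prod_mul_sum_inv_sq_le_gSum χ hq
    rw [← hP_def, ← hS_def] at h1
    have h2 := pi_sq_div_six_sub_le_sum_inv_sq (Nat.sqrt D)
    exact le_trans (mul_le_mul_of_nonneg_left h2 (by linarith)) h1
  -- (J): (3.7)
  have hJ := gSum_sq_le_exp_mul_prod χ hq
  rw [← hS_def, ← hP_def] at hJ
  -- the split primes `≤ √D/2`, with the rate
  have hS1 : ∑ p ∈ (Finset.range (D ^ 2 + 1)).filter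
      (fun p : ℕ => p.Prime ∧ ¬ (Real.sqrt D / 2 < (p : ℝ)) ∧ χ (p : ZMod D) = 1), 1 / (p : ℝ) ≤
      (4 + Real.exp (16 + 4 * Real.log 4) / 2) / Real.log D := by
    have hP : ∀ p ∈ (Finset.range (D ^ 2 + 1)).filter
        (fun p : ℕ => p.Prime ∧ ¬ (Real.sqrt D / 2 < (p : ℝ)) ∧ χ (p : ZMod D) = 1),
        p.Prime ∧ 4 * p ^ 2 ≤ D ∧ χ (p : ZMod D) = 1 := by
      intro p hp
      obtain ⟨-, hpp, hle, hχ⟩ := Finset.mem_filter.mp hp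
      refine ⟨hpp, ?_, hχ⟩
      push Not at hle
      have h2p : 2 * (p : ℝ) ≤ Real.sqrt D := by linarith only [hle]
      have h4 : (4 * (p : ℝ) ^ 2) ≤ D :=
        calc 4 * (p : ℝ) ^ 2 = (2 * p) ^ 2 := by ring
          _ ≤ (Real.sqrt D) ^ 2 := pow_le_pow_left₀ (by positivity) h2p 2
          _ = D := Real.sq_sqrt hD0r.le
      exact_mod_cast h4
    calc _ ≤ (4 / (D : ℝ)) ^ (1 / (2 * h)) + (h - 1) * (4 / (D : ℝ)) ^ (1 / (h + 1)) := by
          rw [hh_def]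
          exact sum_inv_smallSplitPrimes_le_rate h2 hd hKD hprim hquad hodd _ hP
      _ ≤ (4 + Real.exp (16 + 4 * Real.log 4) / 2) / Real.log D :=
          smallSplit_rate_le hDeer hh1 hh
  -- the split primes in `(√D/2, D²]`
  have hS2 : ∑ p ∈ (Finset.range (D ^ 2 + 1)).filter
      (fun p : ℕ => p.Prime ∧ Real.sqrt D / 2 < (p : ℝ) ∧ χ (p : ZMod D) = 1), 1 / (p : ℝ) ≤
      10797 / Real.log D := by
    have hr4 : 4 ≤ Nat.sqrt (Nat.sqrt D) := by
      rw [Nat.le_sqrt', Nat.le_sqrt']; exact le_trans (by norm_num) hD256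
    have hmain := sq_sum_inv_splitPrimes_le χ hprim hq hr4
    rw [hL1] at hmain
    set T := ∑ p ∈ (Finset.range (D ^ 2 + 1)).filter
        (fun p : ℕ => p.Prime ∧ Real.sqrt D / 2 < (p : ℝ) ∧ χ (p : ZMod D) = 1), 1 / (p : ℝ)
      with hT
    have hT0 : 0 ≤ T := by rw [hT]; exact sum_nonneg fun p _ => by positivity
    have hsq : T ^ 2 ≤ (10797 / Real.log D) ^ 2 :=
      hmain.trans (splitBig_sq_le hD256 hLL hh0 hh)
    exact (pow_le_pow_iff_left₀ hT0 (by positivity) two_ne_zero).mp hsq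
  -- all the split primes `≤ D²`
  obtain ⟨σ, hσ_def⟩ : ∃ σ : ℝ, σ = ∑ p ∈ (Finset.range (D ^ 2 + 1)).filter
      (fun p : ℕ => p.Prime ∧ χ (p : ZMod D) = 1), 1 / (p : ℝ) := ⟨_, rfl⟩
  have hσ0 : 0 ≤ σ := by rw [hσ_def]; exact sum_nonneg fun p _ => by positivity
  have hSall : σ ≤ (4 + Real.exp (16 + 4 * Real.log 4) / 2) / Real.log D + 10797 / Real.log D := by
    rw [hσ_def, ← Finset.sum_filter_add_sum_filter_not _ (fun p : ℕ => Real.sqrt D / 2 < (p : ℝ)),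
      Finset.filter_filter, Finset.filter_filter, add_comm]
    refine add_le_add (Eq.trans_le ?_ hS1) (Eq.trans_le ?_ hS2)
    · refine Finset.sum_congr (Finset.filter_congr fun p _ => ?_) fun _ _ => rfl
      tauto
    · refine Finset.sum_congr (Finset.filter_congr fun p _ => ?_) fun _ _ => rfl
      tauto
  rw [← hσ_def] at hJ
  -- the real bookkeeping
  obtain ⟨r, hr_def⟩ : ∃ r : ℝ, r = 1 / Real.log D := ⟨_, rfl⟩
  have hr0 : 0 ≤ r := by rw [hr_def]; positivity
  have hAr : ∀ c : ℝ, c ≤ A → c / Real.log D ≤ A * r := by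
    intro c hc; rw [hr_def, mul_one_div]; exact div_le_div_of_nonneg_right hc hlog0.le
  have hM0 : 0 ≤ (2 * Real.log D + Real.eulerMascheroniConstant) * (Real.pi * h / Real.sqrt D) := by
    have hγ : 0 < Real.eulerMascheroniConstant :=
      lt_trans (by norm_num) Real.one_half_lt_eulerMascheroniConstant
    positivity
  have hexp0 : 0 < Real.exp (16 + 4 * Real.log 4) := Real.exp_pos _
  have hEr : 8 * (Real.sqrt D * (1 + Real.log D)) * (2 * Real.log D + 1) / ((D : ℝ) + 1) +
      4 / (D : ℝ) ≤ A * r :=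
    (lemmaOne_error_le hD3r).trans (hAr _ (by rw [hA_def]; linarith))
  have hMr : (2 * Real.log D + Real.eulerMascheroniConstant) * (Real.pi * h / Real.sqrt D) ≤
      A * r :=
    (logTerm_le hD3r hLL hh0 hh).trans (hAr _ (by rw [hA_def]; linarith))
  have hνr : 2 / ((Nat.sqrt D : ℝ) + 1) ≤ A * r :=
    (zetaTwoTail_le hD3).trans (hAr _ (by rw [hA_def]; linarith))
  have hσr : σ ≤ A * r := by
    refine hSall.trans ?_
    rw [← add_div]
    exact hAr _ (by rw [hA_def]; linarith)
  have h16 : 16 * A * r ≤ 1 := by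
    rw [hr_def, mul_one_div, div_le_one hlog0]; exact h16A
  have hreal := lemma1_real hP1 hM0 hσ0 hr0 hA0 hE hB hJ hEr hMr hνr hσr h16
  rw [hPe]
  refine ⟨?_, hreal.2⟩
  calc |(deriv χ.LFunction 1).re / (P * (Real.pi ^ 2 / 6)) - 1| ≤ 11 * A * r := hreal.1
    _ = 11 * A / Real.log D := by rw [hr_def, mul_one_div]

end LemmaOneAssembly

/-- **Pintz 1976 (III), Lemma 1 — the named fact `pintz1976Deuring_lemma1` DISCHARGED**: for an
imaginary quadratic field `K` with `D = |d_K| > D₁` and `h_K ≤ log D/(2 log log D)`, and `χ` the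
odd real primitive character mod `D`, `L'(1, χ) = ∏_{p∣D}(1 + 1/p)(π²/6)(1 + O(1/log D)) > 1`
(2.1). The road is Pintz's ("This is Theorem 2 in [6]", i.e. part II §3 with the rate kept
explicit): (2.3) `Σ_{n≤D²} g(n)/n = L'(1) + (2 log D + γ)L(1) + O(log²D/√D)` with `L(1) = πh/√D`;
(2.8) `Σ ≥ ∏(1+1/p)(π²/6 − 2/⌊√D⌋)`; (3.7) `Σ ≤ exp(4Σ_{p≤D², χ(p)=1} 1/p)(π²/6)∏(1+1/p)` with
(3.5) for the split primes in `(√D/2, D²]` and, for those `≤ √D/2`, the class-number count (3.2)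
refined to "at most one split prime below `(√D/2)^{2/(h+1)}`" (`sum_inv_smallSplitPrimes_le_rate`),
which yields the rate `1/log D` in place of the `2/log log D` of (3.4).
[cite: Pintz1976ElementaryIII, Lemma 1 p. 297 (2.1)]
[cite: Pintz1976ElementaryII, Theorem 2 p. 276, proof §3 pp. 282–283] -/
theorem _root_.Literature.NumberTheory.LFunctions.pintz1976Deuring_lemma1_holds :
    pintz1976Deuring_lemma1 := by
  obtain ⟨C, D₁, hD₁⟩ := lemma1_aux
  exact ⟨C, D₁, fun K _ _ _ h2 hd hD hh χ hquad hprim hodd =>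
    hD₁ _ K h2 hd rfl hD hh χ hquad hprim hodd⟩

/-! ## Part N. `L(s, χ)`, `L'`, `L''` near `s = 1` (the "known inequality" (2.3) `L''(s) = O(log³D)`) -/

section NearOne

variable {q : ℕ} [NeZero q] (χ : DirichletCharacter ℂ q)

/-- For `q ≥ 3`: the Pólya–Vinogradov constant of the tree is `≤ 9 √q log q`. [folklore] -/
private theorem partialSum_le_nine (hχ : χ ≠ 1) (hq : 3 ≤ q) (n : ℕ) :
    ‖partialSum χ n‖ ≤ 9 * Real.sqrt q * Real.log q := by
  refine (norm_partialSum_le_pv χ hχ n).trans ?_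
  have hq3 : (3 : ℝ) ≤ q := by exact_mod_cast hq
  have hlog1 : 1 ≤ Real.log q := by
    rw [← Real.log_exp 1]
    exact Real.log_le_log (Real.exp_pos 1)
      (le_trans (le_of_lt (lt_trans Real.exp_one_lt_d9 (by norm_num))) hq3)
  have hlog0 : 0 < Real.log q := by linarith
  have hll : Real.log (Real.log q) ≤ Real.log q := by
    have := Real.log_le_sub_one_of_pos hlog0
    linarith
  have hpi : 9 ≤ Real.pi ^ 2 := by nlinarith [Real.pi_gt_three]
  have hsq : 0 ≤ Real.sqrt q := Real.sqrt_nonneg _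
  have h1 : 4 / Real.pi ^ 2 ≤ 4 / 9 := div_le_div_of_nonneg_left (by norm_num) (by norm_num) hpi
  have h2 : 8 / Real.pi ^ 2 ≤ 8 / 9 := div_le_div_of_nonneg_left (by norm_num) (by norm_num) hpi
  have e1 : 4 / Real.pi ^ 2 * Real.sqrt q * Real.log q ≤ 4 / 9 * Real.sqrt q * Real.log q := by
    gcongr
  have e2 : 8 / Real.pi ^ 2 * Real.sqrt q * Real.log (Real.log q) ≤
      8 / 9 * Real.sqrt q * Real.log q := by
    calc 8 / Real.pi ^ 2 * Real.sqrt q * Real.log (Real.log q)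
        ≤ 8 / Real.pi ^ 2 * Real.sqrt q * Real.log q :=
          mul_le_mul_of_nonneg_left hll (by positivity)
      _ ≤ 8 / 9 * Real.sqrt q * Real.log q := by gcongr
  have e3 : 15 / 2 * Real.sqrt q ≤ 15 / 2 * Real.sqrt q * Real.log q := by nlinarith
  nlinarith

/-- `Σ_{n ≤ q} 1/n ≤ 1 + log q`. [folklore] -/
private theorem sum_Ioc_inv_le' (K : ℕ) : ∑ m ∈ Ioc 0 K, ((m : ℝ))⁻¹ ≤ 1 + Real.log K := by
  have h := harmonic_le_one_add_log K
  have e : Ioc 0 K = Icc 1 K := rfl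
  rw [e]
  simpa [harmonic_eq_sum_Icc, Rat.cast_sum, Rat.cast_inv, Rat.cast_natCast] using h

omit [NeZero q] in
/-- For `1 ≤ n ≤ q` and `σ ≥ 1 − 1/log q` (`q ≥ 3`): `n^{−σ} ≤ e/n`. [folklore] -/
private theorem rpow_neg_le_exp_div {σ : ℝ} (hq : 3 ≤ q) (hσ : 1 - 1 / Real.log q ≤ σ) {n : ℕ}
    (hn : 1 ≤ n) (hnq : n ≤ q) : (n : ℝ) ^ (-σ) ≤ Real.exp 1 / n := by
  have hq3 : (3 : ℝ) ≤ q := by exact_mod_cast hq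
  have hn0 : (0 : ℝ) < n := by exact_mod_cast hn
  have hn1 : (1 : ℝ) ≤ n := by exact_mod_cast hn
  have hlogq : 1 ≤ Real.log q := by
    rw [← Real.log_exp 1]
    exact Real.log_le_log (Real.exp_pos 1)
      (le_trans (le_of_lt (lt_trans Real.exp_one_lt_d9 (by norm_num))) hq3)
  have hlogq0 : 0 < Real.log q := by linarith
  have hlogn : Real.log n ≤ Real.log q := Real.log_le_log hn0 (by exact_mod_cast hnq)
  have hlogn0 : 0 ≤ Real.log n := Real.log_nonneg hn1
  rw [Real.rpow_def_of_pos hn0]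
  have : Real.log n * -σ ≤ 1 - Real.log n := by
    have h1 : Real.log n * -σ ≤ Real.log n * -(1 - 1 / Real.log q) :=
      mul_le_mul_of_nonneg_left (by linarith) hlogn0
    have h2 : Real.log n * (1 / Real.log q) ≤ 1 := by
      rw [mul_one_div, div_le_one hlogq0]; exact hlogn
    nlinarith
  calc Real.exp (Real.log n * -σ) ≤ Real.exp (1 - Real.log n) := Real.exp_le_exp.mpr this
    _ = Real.exp 1 / n := by rw [Real.exp_sub, Real.exp_log hn0]

/-- **`L(s, χ) = O(log q)` near `1`**: for `χ ≠ χ₀` mod `q ≥ 3` with `log q ≥ 2` and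
`‖s − 1‖ ≤ 1/log q`: `‖L(s, χ)‖ ≤ 141 log q`. (Partial summation: `Σ_{n≤q} χ(n)n^{−s} = O(log q)`
and the Pólya–Vinogradov tail `O(√q log q · q^{−σ})`; the first step of "the known inequality (2.3)
… which one can easily prove by partial summation".) [cite: Pintz1976ElementaryIII, §2 (2.3) p. 297] -/
theorem norm_LFunction_le_near_one (hχ : χ ≠ 1) (hq : 3 ≤ q) (hlog2 : 2 ≤ Real.log q) {s : ℂ}
    (hs : ‖s - 1‖ ≤ 1 / Real.log q) : ‖χ.LFunction s‖ ≤ 141 * Real.log q := by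
  have hq3 : (3 : ℝ) ≤ q := by exact_mod_cast hq
  have hq0 : (0 : ℝ) < q := by linarith
  have hq1 : 1 ≤ q := le_trans (by norm_num) hq
  have hlogq0 : 0 < Real.log q := by linarith
  have hsqrt1 : 1 ≤ Real.sqrt q := by
    rw [show (1 : ℝ) = Real.sqrt 1 by simp]; exact Real.sqrt_le_sqrt (by linarith)
  -- `σ ≥ 1 − 1/log q ≥ 1/2`, `‖s‖ ≤ 2`
  have hre : 1 - 1 / Real.log q ≤ s.re := by
    have h1 : |(s - 1).re| ≤ ‖s - 1‖ := Complex.abs_re_le_norm _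
    rw [Complex.sub_re, Complex.one_re] at h1
    have := (abs_le.mp (h1.trans hs)).1
    linarith
  have hhalf : 1 / Real.log q ≤ 1 / 2 := one_div_le_one_div_of_le (by norm_num) hlog2
  have hσ : 1 / 2 ≤ s.re := by linarith
  have hσ0 : 0 < s.re := by linarith
  have hs2 : ‖s‖ ≤ 2 := by
    calc ‖s‖ = ‖(s - 1) + 1‖ := by ring_nf
      _ ≤ ‖s - 1‖ + ‖(1 : ℂ)‖ := norm_add_le _ _
      _ ≤ 1 / 2 + 1 := by rw [norm_one]; linarith
      _ ≤ 2 := by norm_num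
  -- the head `Σ_{n ≤ q} χ(n) n^{-s}`
  have hhead : ‖∑ n ∈ Ioc 0 q, χ n * (n : ℂ) ^ (-s)‖ ≤ Real.exp 1 * (1 + Real.log q) := by
    refine (norm_sum_le _ _).trans ?_
    calc ∑ n ∈ Ioc 0 q, ‖χ n * (n : ℂ) ^ (-s)‖ ≤ ∑ n ∈ Ioc 0 q, Real.exp 1 * ((n : ℝ))⁻¹ := by
          refine sum_le_sum fun n hn => ?_
          have hn1 : 1 ≤ n := (mem_Ioc.mp hn).1
          have hnq : n ≤ q := (mem_Ioc.mp hn).2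
          rw [norm_mul, norm_natCast_cpow_of_pos hn1, neg_re]
          calc ‖χ n‖ * (n : ℝ) ^ (-s.re) ≤ 1 * (n : ℝ) ^ (-s.re) :=
                mul_le_mul_of_nonneg_right (χ.norm_le_one _) (by positivity)
            _ ≤ Real.exp 1 / n := by rw [one_mul]; exact rpow_neg_le_exp_div hq hre hn1 hnq
            _ = Real.exp 1 * ((n : ℝ))⁻¹ := by rw [div_eq_mul_inv]
      _ = Real.exp 1 * ∑ n ∈ Ioc 0 q, ((n : ℝ))⁻¹ := by rw [mul_sum]
      _ ≤ Real.exp 1 * (1 + Real.log q) :=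
          mul_le_mul_of_nonneg_left (sum_Ioc_inv_le' q) (Real.exp_pos 1).le
  -- the tail
  have htail := norm_sum_char_cpow_sub_LFunction_le χ hχ (partialSum_le_nine χ hχ hq) hσ0 hq1
  have hqσ : (q : ℝ) ^ (-s.re) ≤ Real.exp 1 / q := rpow_neg_le_exp_div hq hre hq1 le_rfl
  have hfac : 1 + ‖s‖ / s.re ≤ 5 := by
    have : ‖s‖ / s.re ≤ 4 := by
      rw [div_le_iff₀ hσ0]; linarith
    linarith
  have htail' : 9 * Real.sqrt q * Real.log q * (1 + ‖s‖ / s.re) * (q : ℝ) ^ (-s.re) ≤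
      45 * Real.exp 1 * Real.log q := by
    have hB0 : 0 ≤ 9 * Real.sqrt q * Real.log q := by positivity
    calc 9 * Real.sqrt q * Real.log q * (1 + ‖s‖ / s.re) * (q : ℝ) ^ (-s.re)
        ≤ 9 * Real.sqrt q * Real.log q * 5 * (Real.exp 1 / q) := by
          apply mul_le_mul (mul_le_mul_of_nonneg_left hfac hB0) hqσ (by positivity) (by positivity)
      _ = 45 * Real.exp 1 * Real.log q * (Real.sqrt q / q) := by ring
      _ ≤ 45 * Real.exp 1 * Real.log q * 1 := by
          refine mul_le_mul_of_nonneg_left ?_ (by positivity)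
          rw [div_le_one hq0]
          calc Real.sqrt q ≤ Real.sqrt q * Real.sqrt q := le_mul_of_one_le_right (by positivity) hsqrt1
            _ = q := Real.mul_self_sqrt hq0.le
      _ = 45 * Real.exp 1 * Real.log q := by ring
  have he3 : Real.exp 1 ≤ 3 := (lt_trans Real.exp_one_lt_d9 (by norm_num)).le
  have hlog1 : 1 ≤ Real.log q := by linarith
  calc ‖χ.LFunction s‖
      = ‖(∑ n ∈ Ioc 0 q, χ n * (n : ℂ) ^ (-s)) -
          ((∑ n ∈ Ioc 0 q, χ n * (n : ℂ) ^ (-s)) - χ.LFunction s)‖ := by ring_nf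
    _ ≤ ‖∑ n ∈ Ioc 0 q, χ n * (n : ℂ) ^ (-s)‖ +
          ‖(∑ n ∈ Ioc 0 q, χ n * (n : ℂ) ^ (-s)) - χ.LFunction s‖ := norm_sub_le _ _
    _ ≤ Real.exp 1 * (1 + Real.log q) + 45 * Real.exp 1 * Real.log q :=
        add_le_add hhead (htail.trans htail')
    _ ≤ 3 * (2 * Real.log q) + 45 * 3 * Real.log q := by
        have h1 : Real.exp 1 * (1 + Real.log q) ≤ 3 * (2 * Real.log q) :=
          mul_le_mul he3 (by linarith) (by positivity) (by norm_num)
        have h2 : 45 * Real.exp 1 * Real.log q ≤ 45 * 3 * Real.log q := by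
          have := mul_le_mul_of_nonneg_right he3 (by positivity : (0:ℝ) ≤ 45 * Real.log q)
          linarith
        linarith
    _ = 141 * Real.log q := by ring

/-- `L'(s, χ)` is entire for `χ ≠ χ₀`. [folklore] -/
private theorem differentiable_deriv_LFunction (hχ : χ ≠ 1) :
    Differentiable ℂ (deriv χ.LFunction) := by
  have h := ((DirichletCharacter.differentiable_LFunction hχ).contDiff (n := 2)).differentiable_iteratedDeriv
    1 (by norm_num)
  rwa [iteratedDeriv_one] at h

/-- **`L'(s, χ) = O(log²q)`** on `‖s − 1‖ ≤ 2/(3 log q)` (Cauchy's estimate on circles of radius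
`1/(3 log q)`): `‖L'(s, χ)‖ ≤ 423 log²q` (the second step towards (2.3)).
[cite: Pintz1976ElementaryIII, §2 (2.3) p. 297] -/
theorem norm_deriv_LFunction_le_near_one (hχ : χ ≠ 1) (hq : 3 ≤ q) (hlog2 : 2 ≤ Real.log q)
    {s : ℂ} (hs : ‖s - 1‖ ≤ 2 / (3 * Real.log q)) :
    ‖deriv χ.LFunction s‖ ≤ 423 * Real.log q ^ 2 := by
  have hlog0 : 0 < Real.log q := by linarith
  have hR : 0 < 1 / (3 * Real.log q) := by positivity
  have hC : ∀ z ∈ sphere s (1 / (3 * Real.log q)), ‖χ.LFunction z‖ ≤ 141 * Real.log q := by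
    intro z hz
    refine norm_LFunction_le_near_one χ hχ hq hlog2 ?_
    have hz' : ‖z - s‖ = 1 / (3 * Real.log q) := by rwa [mem_sphere, dist_eq_norm] at hz
    calc ‖z - 1‖ = ‖(z - s) + (s - 1)‖ := by ring_nf
      _ ≤ ‖z - s‖ + ‖s - 1‖ := norm_add_le _ _
      _ ≤ 1 / (3 * Real.log q) + 2 / (3 * Real.log q) := by rw [hz']; linarith
      _ = 1 / Real.log q := by field_simp; norm_num
  have h := Complex.norm_deriv_le_of_forall_mem_sphere_norm_le hR
    ((DirichletCharacter.differentiable_LFunction hχ).diffContOnCl) hC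
  calc ‖deriv χ.LFunction s‖ ≤ 141 * Real.log q / (1 / (3 * Real.log q)) := h
    _ = 423 * Real.log q ^ 2 := by field_simp; ring

/-- **(2.3): `L''(s, χ) = O(log³q)`** on `‖s − 1‖ ≤ 1/(3 log q)`: `‖L''(s, χ)‖ ≤ 1269 log³q`.
[cite: Pintz1976ElementaryIII, §2 (2.3) p. 297] -/
theorem norm_deriv_deriv_LFunction_le_near_one (hχ : χ ≠ 1) (hq : 3 ≤ q) (hlog2 : 2 ≤ Real.log q)
    {s : ℂ} (hs : ‖s - 1‖ ≤ 1 / (3 * Real.log q)) :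
    ‖deriv (deriv χ.LFunction) s‖ ≤ 1269 * Real.log q ^ 3 := by
  have hlog0 : 0 < Real.log q := by linarith
  have hR : 0 < 1 / (3 * Real.log q) := by positivity
  have hC : ∀ z ∈ sphere s (1 / (3 * Real.log q)), ‖deriv χ.LFunction z‖ ≤ 423 * Real.log q ^ 2 := by
    intro z hz
    refine norm_deriv_LFunction_le_near_one χ hχ hq hlog2 ?_
    have hz' : ‖z - s‖ = 1 / (3 * Real.log q) := by rwa [mem_sphere, dist_eq_norm] at hz
    calc ‖z - 1‖ = ‖(z - s) + (s - 1)‖ := by ring_nf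
      _ ≤ ‖z - s‖ + ‖s - 1‖ := norm_add_le _ _
      _ ≤ 1 / (3 * Real.log q) + 1 / (3 * Real.log q) := by rw [hz']; linarith
      _ = 2 / (3 * Real.log q) := by ring
  have h := Complex.norm_deriv_le_of_forall_mem_sphere_norm_le hR
    ((differentiable_deriv_LFunction χ hχ).diffContOnCl) hC
  calc ‖deriv (deriv χ.LFunction) s‖ ≤ 423 * Real.log q ^ 2 / (1 / (3 * Real.log q)) := h
    _ = 1269 * Real.log q ^ 3 := by field_simp; ring

/-- **Lemma 2 (quantitative form):** for `‖s − 1‖ ≤ 1/(3 log q)`,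
`‖L'(s, χ) − L'(1, χ)‖ ≤ 1269 log³q · ‖s − 1‖` (mean value inequality with (2.3)); on
`H = {|1 − s| ≤ 1/log⁴q}` this is `≤ 1269/log q`. [cite: Pintz1976ElementaryIII, Lemma 2 p. 297 (2.2)] -/
theorem norm_deriv_LFunction_sub_le (hχ : χ ≠ 1) (hq : 3 ≤ q) (hlog2 : 2 ≤ Real.log q)
    {s : ℂ} (hs : ‖s - 1‖ ≤ 1 / (3 * Real.log q)) :
    ‖deriv χ.LFunction s - deriv χ.LFunction 1‖ ≤ 1269 * Real.log q ^ 3 * ‖s - 1‖ := by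
  have hconv : Convex ℝ (closedBall (1 : ℂ) (1 / (3 * Real.log q))) := convex_closedBall _ _
  have hmem : ∀ z ∈ closedBall (1 : ℂ) (1 / (3 * Real.log q)), ‖z - 1‖ ≤ 1 / (3 * Real.log q) :=
    fun z hz => by rwa [mem_closedBall, dist_eq_norm] at hz
  exact hconv.norm_image_sub_le_of_norm_deriv_le
    (fun z _ => (differentiable_deriv_LFunction χ hχ z))
    (fun z hz => norm_deriv_deriv_LFunction_le_near_one χ hχ hq hlog2 (hmem z hz))
    (mem_closedBall_self (by positivity)) (by rw [mem_closedBall, dist_eq_norm]; exact hs)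

/-- **(2.4) (quantitative form):** for `s₁, s₂` with `‖sᵢ − 1‖ ≤ ρ ≤ 1/(3 log q)`,
`‖L(s₂) − L(s₁) − (s₂ − s₁)L'(1)‖ ≤ 1269 log³q · ρ · ‖s₂ − s₁‖` (mean value inequality for
`L(z) − z L'(1)`, whose derivative `L'(z) − L'(1)` is `≤ 1269 log³q · ρ` on the ball).
[cite: Pintz1976ElementaryIII, Lemma 3 p. 297 (2.4)] -/
theorem norm_LFunction_sub_sub_le (hχ : χ ≠ 1) (hq : 3 ≤ q) (hlog2 : 2 ≤ Real.log q) {ρ : ℝ}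
    (hρ : ρ ≤ 1 / (3 * Real.log q)) {s₁ s₂ : ℂ} (hs₁ : ‖s₁ - 1‖ ≤ ρ) (hs₂ : ‖s₂ - 1‖ ≤ ρ) :
    ‖χ.LFunction s₂ - χ.LFunction s₁ - (s₂ - s₁) * deriv χ.LFunction 1‖ ≤
      1269 * Real.log q ^ 3 * ρ * ‖s₂ - s₁‖ := by
  have hlog0 : 0 < Real.log q := by linarith
  have hρ0 : 0 ≤ ρ := (norm_nonneg _).trans hs₁
  have hconv : Convex ℝ (closedBall (1 : ℂ) ρ) := convex_closedBall _ _
  have hdiff := DirichletCharacter.differentiable_LFunction hχ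
  set g : ℂ → ℂ := fun z => χ.LFunction z - z * deriv χ.LFunction 1 with hg
  have hgd : ∀ z, HasDerivAt g (deriv χ.LFunction z - deriv χ.LFunction 1) z := by
    intro z
    have h1 := (hdiff z).hasDerivAt
    have h2 : HasDerivAt (fun z : ℂ => z * deriv χ.LFunction 1) (deriv χ.LFunction 1) z := by
      simpa using (hasDerivAt_id z).mul_const (deriv χ.LFunction 1)
    exact h1.sub h2
  have hbound : ∀ z ∈ closedBall (1 : ℂ) ρ, ‖deriv g z‖ ≤ 1269 * Real.log q ^ 3 * ρ := by
    intro z hz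
    rw [(hgd z).deriv]
    have hz1 : ‖z - 1‖ ≤ ρ := by rwa [mem_closedBall, dist_eq_norm] at hz
    calc ‖deriv χ.LFunction z - deriv χ.LFunction 1‖ ≤ 1269 * Real.log q ^ 3 * ‖z - 1‖ :=
          norm_deriv_LFunction_sub_le χ hχ hq hlog2 (hz1.trans hρ)
      _ ≤ 1269 * Real.log q ^ 3 * ρ := mul_le_mul_of_nonneg_left hz1 (by positivity)
  have h := hconv.norm_image_sub_le_of_norm_deriv_le (fun z _ => (hgd z).differentiableAt) hbound
    (by rw [mem_closedBall, dist_eq_norm]; exact hs₁) (by rw [mem_closedBall, dist_eq_norm]; exact hs₂)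
  have e : g s₂ - g s₁ = χ.LFunction s₂ - χ.LFunction s₁ - (s₂ - s₁) * deriv χ.LFunction 1 := by
    simp only [hg]; ring
  rw [e] at h
  exact h

end NearOne

/-! ## Part O. Theorem 1 (p. 298): the real zero by the intermediate value theorem, its uniqueness
and simplicity by Lemmas 2–3, and (1.5)–(1.6) -/

section TheoremOneAssembly

open Literature.NumberTheory.QuadraticFields

/-- `π log⁵x ≤ √x` for `x ≥ 12800000⁴` (`log⁵x ≤ 20⁵x^{1/4}`, `π ≤ 4`). [folklore] -/
private theorem pi_mul_log_pow_five_le_sqrt {x : ℝ} (hx : (12800000 : ℝ) ^ 4 ≤ x) :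
    Real.pi * Real.log x ^ 5 ≤ Real.sqrt x := by
  have hx1 : 1 ≤ x := le_trans (by norm_num) hx
  have hx0 : 0 ≤ x := by linarith
  have h := Real.log_le_rpow_div hx0 (show (0 : ℝ) < (1 / 4) / 5 by norm_num)
  have hlog0 : 0 ≤ Real.log x := Real.log_nonneg hx1
  have h5 : Real.log x ^ 5 ≤ 20 ^ 5 * x ^ (1 / 4 : ℝ) := by
    have h' : Real.log x ≤ 20 * x ^ ((1 / 4 : ℝ) / 5) := by
      calc Real.log x ≤ x ^ ((1 / 4 : ℝ) / 5) / ((1 / 4) / 5) := h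
        _ = 20 * x ^ ((1 / 4 : ℝ) / 5) := by ring
    calc Real.log x ^ 5 ≤ (20 * x ^ ((1 / 4 : ℝ) / 5)) ^ 5 := pow_le_pow_left₀ hlog0 h' 5
      _ = 20 ^ 5 * (x ^ ((1 / 4 : ℝ) / 5)) ^ 5 := mul_pow _ _ _
      _ = 20 ^ 5 * x ^ (1 / 4 : ℝ) := by
          rw [← Real.rpow_natCast (x ^ ((1 / 4 : ℝ) / 5)) 5, ← Real.rpow_mul hx0]
          norm_num
  have hroot : (12800000 : ℝ) ≤ x ^ (1 / 4 : ℝ) := by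
    have h' : ((12800000 : ℝ) ^ 4) ^ (1 / 4 : ℝ) ≤ x ^ (1 / 4 : ℝ) :=
      Real.rpow_le_rpow (by positivity) hx (by norm_num)
    have e : ((12800000 : ℝ) ^ 4) ^ (1 / 4 : ℝ) = 12800000 := by
      rw [show (1 / 4 : ℝ) = ((4 : ℕ) : ℝ)⁻¹ by norm_num,
        Real.pow_rpow_inv_natCast (by norm_num) (by norm_num)]
    rw [e] at h'; exact h'
  have hsq : x ^ (1 / 4 : ℝ) * x ^ (1 / 4 : ℝ) = Real.sqrt x := by
    rw [← Real.rpow_add' hx0 (by norm_num), Real.sqrt_eq_rpow]; norm_num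
  have h40 : 0 ≤ x ^ (1 / 4 : ℝ) := Real.rpow_nonneg hx0 _
  calc Real.pi * Real.log x ^ 5 ≤ 4 * (20 ^ 5 * x ^ (1 / 4 : ℝ)) :=
        mul_le_mul Real.pi_le_four h5 (by positivity) (by norm_num)
    _ = 12800000 * x ^ (1 / 4 : ℝ) := by ring
    _ ≤ x ^ (1 / 4 : ℝ) * x ^ (1 / 4 : ℝ) := mul_le_mul_of_nonneg_right hroot h40
    _ = Real.sqrt x := hsq

/-- The ratio bookkeeping of (1.5): from `|δ L'(1) − L(1)| ≤ a L(1)` and `|L'(1) − Z| ≤ b Z`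
(`b ≤ 1/2`), `|δ/(L(1)/Z) − 1| ≤ 2(a + b)`. [folklore] -/
private theorem ratio_bound {L1 L1' Z δ a b : ℝ} (hL1 : 0 < L1) (hZ : 0 < Z)
    (hu : |δ * L1' - L1| ≤ a * L1) (hv : |L1' - Z| ≤ b * Z) (hb : b ≤ 1 / 2) :
    |δ / (L1 / Z) - 1| ≤ 2 * (a + b) := by
  have hv' := abs_le.mp hv
  have hbZ : b * Z ≤ 1 / 2 * Z := mul_le_mul_of_nonneg_right hb hZ.le
  have hL1'Z : Z / 2 ≤ L1' := by linarith [hv'.1]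
  have hL1'0 : 0 < L1' := by linarith
  have key : L1' * (δ * Z - L1) = (δ * L1' - L1) * Z - L1 * (L1' - Z) := by ring
  have h1 : |L1' * (δ * Z - L1)| ≤ a * L1 * Z + L1 * (b * Z) := by
    rw [key]
    calc |(δ * L1' - L1) * Z - L1 * (L1' - Z)| ≤ |(δ * L1' - L1) * Z| + |L1 * (L1' - Z)| :=
          abs_sub _ _
      _ = |δ * L1' - L1| * Z + L1 * |L1' - Z| := by
          rw [abs_mul, abs_mul, abs_of_pos hZ, abs_of_pos hL1]
      _ ≤ a * L1 * Z + L1 * (b * Z) :=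
          add_le_add (mul_le_mul_of_nonneg_right hu hZ.le) (mul_le_mul_of_nonneg_left hv hL1.le)
  rw [abs_mul, abs_of_pos hL1'0] at h1
  have h2 : Z / 2 * |δ * Z - L1| ≤ L1 * Z * (a + b) := by
    calc Z / 2 * |δ * Z - L1| ≤ L1' * |δ * Z - L1| :=
          mul_le_mul_of_nonneg_right hL1'Z (abs_nonneg _)
      _ ≤ a * L1 * Z + L1 * (b * Z) := h1
      _ = L1 * Z * (a + b) := by ring
  have h3 : |δ * Z - L1| ≤ 2 * L1 * (a + b) := by
    have := mul_le_mul_of_nonneg_left h2 (show (0 : ℝ) ≤ 2 / Z by positivity)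
    have e1 : 2 / Z * (Z / 2 * |δ * Z - L1|) = |δ * Z - L1| := by field_simp
    have e2 : 2 / Z * (L1 * Z * (a + b)) = 2 * L1 * (a + b) := by field_simp
    rw [e1, e2] at this; exact this
  have hid : δ / (L1 / Z) - 1 = (δ * Z - L1) / L1 := by field_simp
  rw [hid, abs_div, abs_of_pos hL1, div_le_iff₀ hL1]
  calc |δ * Z - L1| ≤ 2 * L1 * (a + b) := h3
    _ = 2 * (a + b) * L1 := by ring

/-- **Theorem 1 with the modulus as a separate variable** (`D = |d_K|`, `χ` the odd real primitive
character mod `D`, `h_K ≤ log D/(2 log log D)`, `D > D₁`): a single simple real zero `1 − δ` in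
`H = {|1 − s| ≤ 1/log⁴D}` with (1.5) and (1.6).
[cite: Pintz1976ElementaryIII, Theorem 1 p. 296 (1.3)–(1.6), proof p. 298] -/
theorem theorem1_aux :
    ∃ C : ℝ, ∃ D₁ : ℕ, ∀ (D : ℕ) [NeZero D] (K : Type) [Field K] [NumberField K],
      Module.finrank ℚ K = 2 → NumberField.discr K < 0 → (NumberField.discr K).natAbs = D →
      D₁ < D →
      (NumberField.classNumber K : ℝ) ≤ Real.log D / (2 * Real.log (Real.log D)) →
      ∀ χ : DirichletCharacter ℂ D, χ.IsQuadratic → χ.IsPrimitive → χ.Odd →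
      ∃ δ : ℝ, |δ| ≤ 1 / Real.log D ^ 4 ∧
        χ.LFunction ((1 - δ : ℝ) : ℂ) = 0 ∧ deriv χ.LFunction ((1 - δ : ℝ) : ℂ) ≠ 0 ∧
        (∀ s : ℂ, s ∈ nearOne D → χ.LFunction s = 0 → s = ((1 - δ : ℝ) : ℂ)) ∧
        |δ / ((χ.LFunction 1).re / (eulerFactor D * (Real.pi ^ 2 / 6))) - 1| ≤ C / Real.log D ∧
        |δ / (6 * (NumberField.classNumber K : ℝ) /
              (eulerFactor D * Real.pi * Real.sqrt D)) - 1| ≤ C / Real.log D ∧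
        ∀ s : ℂ, s ∈ nearOne D →
          ‖(χ.LFunction s - χ.LFunction 1) - (s - 1) * (eulerFactor D * (Real.pi ^ 2 / 6) : ℝ)‖ ≤
            ‖(s - 1) * (eulerFactor D * (Real.pi ^ 2 / 6) : ℝ)‖ * C / Real.log D := by
  obtain ⟨C₁, D₁, hLem1⟩ := lemma1_aux
  obtain ⟨T, hT_def⟩ : ∃ T : ℝ, T = 4 * 1269 + 2 * |C₁| := ⟨_, rfl⟩
  have hT0 : 5076 ≤ T := by rw [hT_def]; have := abs_nonneg C₁; linarith
  refine ⟨T, max D₁ (max (max ⌈Real.exp (Real.exp 1)⌉₊ ⌈((12800000 : ℝ) ^ 4)⌉₊) (max 5 ⌈Real.exp T⌉₊)), ?_⟩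
  intro D _ K _ _ h2 hd hKD hD1 hh χ hquad hprim hodd
  classical
  -- thresholds
  have hDD₁ : D₁ < D := lt_of_le_of_lt (le_max_left _ _) hD1
  have hD1' := hD1.le
  have hDee : ⌈Real.exp (Real.exp 1)⌉₊ ≤ D :=
    le_trans (le_trans (le_max_left _ _) (le_max_left _ _)) (le_trans (le_max_right _ _) hD1')
  have hDbig : ⌈((12800000 : ℝ) ^ 4)⌉₊ ≤ D :=
    le_trans (le_trans (le_max_right _ _) (le_max_left _ _)) (le_trans (le_max_right _ _) hD1')
  have hDT : ⌈Real.exp T⌉₊ ≤ D :=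
    le_trans (le_trans (le_max_right _ _) (le_max_right _ _)) (le_trans (le_max_right _ _) hD1')
  have hD5 : 5 ≤ D :=
    le_trans (le_trans (le_max_left _ _) (le_max_right _ _)) (le_trans (le_max_right _ _) hD1')
  have hD3 : 3 ≤ D := le_trans (by norm_num) hD5
  have hD3r : (3 : ℝ) ≤ D := by exact_mod_cast hD3
  have hD0r : (0 : ℝ) < D := by linarith
  have hDbigr : (12800000 : ℝ) ^ 4 ≤ D := le_trans (Nat.le_ceil _) (by exact_mod_cast hDbig)
  have hlogT : T ≤ Real.log D := by
    have h1 : Real.exp T ≤ D := le_trans (Nat.le_ceil _) (by exact_mod_cast hDT)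
    rw [Real.le_log_iff_exp_le hD0r]; exact h1
  have hlog2 : 2 ≤ Real.log D := by linarith
  have hlog0 : 0 < Real.log D := by linarith
  have hDeer : Real.exp (Real.exp 1) ≤ D := le_trans (Nat.le_ceil _) (by exact_mod_cast hDee)
  have hLL : 1 ≤ Real.log (Real.log D) := by
    have h1 : Real.exp 1 ≤ Real.log D := by rw [Real.le_log_iff_exp_le hD0r]; exact hDeer
    rw [Real.le_log_iff_exp_le hlog0]; exact h1
  -- Lemma 1
  obtain ⟨hC₁, hL1'⟩ := hLem1 D K h2 hd hKD hDD₁ hh χ hquad hprim hodd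
  set L1' := (deriv χ.LFunction 1).re with hL1'_def
  set P := eulerFactor D with hP_def
  have hP1 : 1 ≤ P := by
    rw [hP_def, eulerFactor]
    calc (1 : ℝ) = ∏ _p ∈ D.primeFactors, (1 : ℝ) := by simp
      _ ≤ ∏ p ∈ D.primeFactors, (1 + 1 / (p : ℝ)) :=
          prod_le_prod (fun _ _ => zero_le_one) fun p _ => by
            have : (0 : ℝ) ≤ 1 / (p : ℝ) := by positivity
            linarith
  set Z := P * (Real.pi ^ 2 / 6) with hZ_def
  have hπ3 : 3 < Real.pi := Real.pi_gt_three
  have hZ1 : 1 ≤ Z := by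
    have hπ6 : 1 ≤ Real.pi ^ 2 / 6 := by nlinarith only [hπ3]
    calc (1 : ℝ) = 1 * 1 := by ring
      _ ≤ P * (Real.pi ^ 2 / 6) := mul_le_mul hP1 hπ6 (by norm_num) (by linarith)
  have hZ0 : 0 < Z := by linarith
  have hC₁abs : |C₁| / Real.log D ≤ 1 / 2 := by
    rw [div_le_iff₀ hlog0]; rw [hT_def] at hlogT; linarith [abs_nonneg C₁]
  have hv : |L1' - Z| ≤ |C₁| / Real.log D * Z := by
    have h1 : |L1' / Z - 1| ≤ |C₁| / Real.log D :=
      hC₁.trans (div_le_div_of_nonneg_right (le_abs_self C₁) hlog0.le)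
    have hid : L1' / Z - 1 = (L1' - Z) / Z := by field_simp
    rw [hid, abs_div, abs_of_pos hZ0, div_le_iff₀ hZ0] at h1
    exact h1
  -- the character and `L(1) = π h/√D > 0`
  have hq : χ ^ 2 = 1 := MulChar.IsQuadratic.sq_eq_one hquad
  have hΔ : NumberField.discr K = -(D : ℤ) := by rw [← hKD]; omega
  have hne : χ ≠ 1 := by
    intro h1
    have h := hodd
    rw [DirichletCharacter.Odd, h1, MulChar.one_apply isUnit_one.neg] at h
    norm_num at h
  have hd4 : NumberField.discr K < -4 := by have := hD5; omega
  have hcnf := Quadratic.LFunction_one_eq_of_discr_neg_of_eq h2 hd hne (fun s hs => by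
    rw [← DirichletCharacter.LFunction_eq_LSeries χ (show 1 < (s : ℂ).re by simpa using hs)]
    exact Quadratic.dedekindZeta_eq_riemannZeta_mul_LFunction_of_odd_primitive hprim hquad hodd
      h2 hΔ (by simpa using hs))
  have hw : (NumberField.Units.torsionOrder K : ℝ) = 2 := by
    exact_mod_cast Quadratic.torsionOrder_eq_two_of_discr_lt_neg_four h2 hd4
  have habs : |(NumberField.discr K : ℝ)| = (D : ℝ) := by
    rw [← hKD, Nat.cast_natAbs, Int.cast_abs]
  obtain ⟨h, hh_def⟩ : ∃ h : ℝ, h = (NumberField.classNumber K : ℝ) := ⟨_, rfl⟩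
  rw [← hh_def] at hh ⊢
  have hh1 : 1 ≤ h := by rw [hh_def]; exact_mod_cast NumberField.classNumber_pos K
  have hsqrtD : 0 < Real.sqrt D := Real.sqrt_pos.2 hD0r
  have hπ := Real.pi_pos
  set L1 := (χ.LFunction 1).re with hL1_def
  have hL1 : L1 = Real.pi * h / Real.sqrt D := by
    rw [hL1_def, hcnf, Complex.ofReal_re, hw, habs, hh_def, mul_assoc,
      mul_div_mul_left _ _ (two_ne_zero' ℝ)]
  have hL1pos : 0 < L1 := by rw [hL1]; positivity
  -- `L'(1)` is real: `deriv L 1 = L1'`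
  have hderiv_real : deriv χ.LFunction 1 = (L1' : ℂ) := by
    apply Complex.ext
    · simp [hL1'_def]
    · have := ExceptionalZero.deriv_LFunction_ofReal_im_eq_zero χ hne hq (σ := 1) one_pos
      simpa using this
  have hnormL1' : L1' ≤ ‖deriv χ.LFunction 1‖ := by
    rw [hL1'_def]; exact (le_abs_self _).trans (Complex.abs_re_le_norm _)
  -- the radius `ρ = 1/log⁴D ≤ 1/(3 log D)` and the key inequality (2.4)
  set ρ := 1 / Real.log D ^ 4 with hρ_def
  have hρ0 : 0 < ρ := by positivity
  have hρ3 : ρ ≤ 1 / (3 * Real.log D) := by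
    rw [hρ_def]
    refine one_div_le_one_div_of_le (by positivity) ?_
    have h8 : (8 : ℝ) ≤ Real.log D ^ 3 := by
      have := pow_le_pow_left₀ (by norm_num : (0 : ℝ) ≤ 2) hlog2 3
      norm_num at this; exact this
    calc 3 * Real.log D ≤ Real.log D ^ 3 * Real.log D := by nlinarith only [h8, hlog0]
      _ = Real.log D ^ 4 := by ring
  have hlog3ρ : 1269 * Real.log D ^ 3 * ρ = 1269 / Real.log D := by
    rw [hρ_def]; field_simp
  have hKEY : ∀ s₁ s₂ : ℂ, ‖s₁ - 1‖ ≤ ρ → ‖s₂ - 1‖ ≤ ρ →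
      ‖χ.LFunction s₂ - χ.LFunction s₁ - (s₂ - s₁) * deriv χ.LFunction 1‖ ≤
        1269 / Real.log D * ‖s₂ - s₁‖ := by
    intro s₁ s₂ hs₁ hs₂
    rw [← hlog3ρ]
    exact norm_LFunction_sub_sub_le χ hne hD3 hlog2 hρ3 hs₁ hs₂
  have hmemH : ∀ s : ℂ, s ∈ nearOne D → ‖s - 1‖ ≤ ρ := by
    intro s hs
    rw [nearOne, Set.mem_setOf_eq] at hs
    rwa [norm_sub_rev]
  -- the real points: `|Re L(1−τ) − L(1) + τ L'(1)| ≤ 1269 τ/log D` for `0 ≤ τ ≤ ρ`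
  have hreal : ∀ τ : ℝ, 0 ≤ τ → τ ≤ ρ →
      |(χ.LFunction ((1 - τ : ℝ) : ℂ)).re - L1 + τ * L1'| ≤ 1269 / Real.log D * τ := by
    intro τ hτ0 hτρ
    have hs : ‖((1 - τ : ℝ) : ℂ) - 1‖ ≤ ρ := by
      have : ((1 - τ : ℝ) : ℂ) - 1 = ((-τ : ℝ) : ℂ) := by push_cast; ring
      rw [this, Complex.norm_real, Real.norm_eq_abs, abs_neg, abs_of_nonneg hτ0]; exact hτρ
    have h1 := hKEY 1 _ (by simp; exact hρ0.le) hs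
    have hn : ‖((1 - τ : ℝ) : ℂ) - 1‖ = τ := by
      have : ((1 - τ : ℝ) : ℂ) - 1 = ((-τ : ℝ) : ℂ) := by push_cast; ring
      rw [this, Complex.norm_real, Real.norm_eq_abs, abs_neg, abs_of_nonneg hτ0]
    rw [hn] at h1
    have hre : (χ.LFunction ((1 - τ : ℝ) : ℂ) - χ.LFunction 1 -
        (((1 - τ : ℝ) : ℂ) - 1) * deriv χ.LFunction 1).re =
        (χ.LFunction ((1 - τ : ℝ) : ℂ)).re - L1 + τ * L1' := by
      have : ((1 - τ : ℝ) : ℂ) - 1 = ((-τ : ℝ) : ℂ) := by push_cast; ring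
      rw [this, Complex.sub_re, Complex.sub_re, Complex.re_ofReal_mul, hL1_def, hL1'_def]; ring
    calc |(χ.LFunction ((1 - τ : ℝ) : ℂ)).re - L1 + τ * L1'|
        = |(χ.LFunction ((1 - τ : ℝ) : ℂ) - χ.LFunction 1 -
            (((1 - τ : ℝ) : ℂ) - 1) * deriv χ.LFunction 1).re| := by rw [hre]
      _ ≤ ‖χ.LFunction ((1 - τ : ℝ) : ℂ) - χ.LFunction 1 -
            (((1 - τ : ℝ) : ℂ) - 1) * deriv χ.LFunction 1‖ := Complex.abs_re_le_norm _
      _ ≤ 1269 / Real.log D * τ := h1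
  -- `τ₁ = L(1)/(2L'(1))`, `τ₂ = 2L(1)/L'(1) ≤ ρ`
  set τ₁ := L1 / (2 * L1') with hτ₁
  set τ₂ := 2 * L1 / L1' with hτ₂
  have hL1'0 : 0 < L1' := by linarith
  have hτ₁0 : 0 < τ₁ := by positivity
  have hτ₁₂ : τ₁ ≤ τ₂ := by
    rw [hτ₁, hτ₂, div_le_div_iff₀ (by positivity) hL1'0]; nlinarith only [hL1pos, hL1'0]
  have hτ₂L : τ₂ ≤ 2 * L1 := by
    rw [hτ₂, div_le_iff₀ hL1'0]; nlinarith only [hL1pos, hL1']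
  have hτ₂ρ : τ₂ ≤ ρ := by
    -- `2L(1) = 2πh/√D ≤ π log D/√D ≤ 1/log⁴D`
    have hh2 : h ≤ Real.log D / 2 := by
      refine hh.trans ?_
      rw [div_le_div_iff₀ (by positivity) (by norm_num)]
      nlinarith only [hLL, hlog0]
    have h5 := pi_mul_log_pow_five_le_sqrt hDbigr
    refine hτ₂L.trans ?_
    rw [hL1, hρ_def]
    rw [show 2 * (Real.pi * h / Real.sqrt D) = 2 * Real.pi * h / Real.sqrt D by ring,
      div_le_div_iff₀ hsqrtD (by positivity)]
    calc 2 * Real.pi * h * Real.log D ^ 4 ≤ 2 * Real.pi * (Real.log D / 2) * Real.log D ^ 4 := by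
          gcongr
      _ = Real.pi * Real.log D ^ 5 := by ring
      _ ≤ Real.sqrt D := h5
      _ = 1 * Real.sqrt D := (one_mul _).symm
  have hτ₂0 : 0 ≤ τ₂ := hτ₁0.le.trans hτ₁₂
  have hcoef : 1269 / Real.log D ≤ 1 / 4 := by
    rw [div_le_div_iff₀ hlog0 (by norm_num)]; linarith
  -- signs at the endpoints
  set f : ℝ → ℝ := fun σ => (χ.LFunction (σ : ℂ)).re with hf
  have hfa : f (1 - τ₂) < 0 := by
    have h1 := abs_le.mp (hreal τ₂ hτ₂0 hτ₂ρ)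
    have e : τ₂ * L1' = 2 * L1 := by rw [hτ₂]; field_simp
    have : 1269 / Real.log D * τ₂ ≤ 1 / 4 * (2 * L1) :=
      mul_le_mul hcoef hτ₂L hτ₂0 (by norm_num)
    show (χ.LFunction ((1 - τ₂ : ℝ) : ℂ)).re < 0
    linarith [h1.2]
  have hfb : 0 < f (1 - τ₁) := by
    have h1 := abs_le.mp (hreal τ₁ hτ₁0.le (hτ₁₂.trans hτ₂ρ))
    have e : τ₁ * L1' = L1 / 2 := by rw [hτ₁]; field_simp
    have hτ₁L : τ₁ ≤ L1 / 2 := by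
      rw [hτ₁, div_le_div_iff₀ (by positivity) (by norm_num)]; nlinarith only [hL1pos, hL1']
    have : 1269 / Real.log D * τ₁ ≤ 1 / 4 * (L1 / 2) :=
      mul_le_mul hcoef hτ₁L hτ₁0.le (by norm_num)
    show 0 < (χ.LFunction ((1 - τ₁ : ℝ) : ℂ)).re
    linarith [h1.1]
  -- the intermediate value theorem
  have hcont : ContinuousOn f (Set.Icc (1 - τ₂) (1 - τ₁)) := by
    have hc : Continuous f := Complex.continuous_re.comp
      ((DirichletCharacter.differentiable_LFunction hne).continuous.comp Complex.continuous_ofReal)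
    exact hc.continuousOn
  have hab : 1 - τ₂ ≤ 1 - τ₁ := by linarith
  obtain ⟨σ₀, hσ₀mem, hσ₀⟩ := intermediate_value_Icc hab hcont ⟨hfa.le, hfb.le⟩
  obtain ⟨hσ₀a, hσ₀b⟩ := hσ₀mem
  set δ := 1 - σ₀ with hδ_def
  have hδ₁ : τ₁ ≤ δ := by rw [hδ_def]; linarith
  have hδ₂ : δ ≤ τ₂ := by rw [hδ_def]; linarith
  have hδ0 : 0 < δ := lt_of_lt_of_le hτ₁0 hδ₁
  have hδρ : δ ≤ ρ := hδ₂.trans hτ₂ρ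
  have hσ₀eq : ((1 - δ : ℝ) : ℂ) = (σ₀ : ℂ) := by rw [hδ_def, sub_sub_cancel]
  have hσ₀pos : 0 < σ₀ := by
    have : ρ ≤ 1 / 2 := by
      rw [hρ_def]; refine (one_div_le_one_div_of_le (by norm_num) ?_)
      have := pow_le_pow_left₀ (by norm_num : (0 : ℝ) ≤ 2) hlog2 4
      norm_num at this; linarith
    linarith
  -- the zero
  have hzero : χ.LFunction (σ₀ : ℂ) = 0 := by
    apply Complex.ext
    · simpa [hf] using hσ₀
    · rw [Complex.zero_im]; exact LFunction_ofReal_im_eq_zero χ hne hq hσ₀pos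
  have hσ₀1 : ‖(σ₀ : ℂ) - 1‖ ≤ ρ := by
    rw [← hσ₀eq]
    have : ((1 - δ : ℝ) : ℂ) - 1 = ((-δ : ℝ) : ℂ) := by push_cast; ring
    rw [this, Complex.norm_real, Real.norm_eq_abs, abs_neg, abs_of_pos hδ0]; exact hδρ
  have hsmall : 1269 / Real.log D < 1 := by linarith
  refine ⟨δ, ?_, ?_, ?_, ?_, ?_, ?_, ?_⟩
  · -- `|δ| ≤ 1/log⁴D`
    rw [abs_of_pos hδ0]; exact hδρ
  · rw [hσ₀eq]; exact hzero
  · -- simplicity: `‖L'(1−δ) − L'(1)‖ ≤ 1269/log D < 1 < L'(1)`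
    rw [hσ₀eq]
    intro h0
    have h1 := norm_deriv_LFunction_sub_le χ hne hD3 hlog2 (hσ₀1.trans hρ3)
    rw [h0, zero_sub, norm_neg] at h1
    have h2 : 1269 * Real.log D ^ 3 * ‖(σ₀ : ℂ) - 1‖ ≤ 1269 / Real.log D := by
      rw [← hlog3ρ]; exact mul_le_mul_of_nonneg_left hσ₀1 (by positivity)
    linarith
  · -- uniqueness in `H` (Lemma 3)
    intro s hs hLs
    rw [hσ₀eq]
    by_contra hne'
    have h1 := hKEY (σ₀ : ℂ) s hσ₀1 (hmemH s hs)
    rw [hLs, hzero, sub_zero, zero_sub, norm_neg, norm_mul] at h1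
    have hpos : 0 < ‖s - (σ₀ : ℂ)‖ := norm_pos_iff.mpr (sub_ne_zero.mpr hne')
    have : ‖deriv χ.LFunction 1‖ ≤ 1269 / Real.log D :=
      le_of_mul_le_mul_left (by linarith [h1]) hpos
    linarith
  · -- (1.5), first form
    have hu : |δ * L1' - L1| ≤ 2538 / Real.log D * L1 := by
      have h1 := hreal δ hδ0.le hδρ
      rw [hσ₀eq] at h1
      have h0 : (χ.LFunction (σ₀ : ℂ)).re = 0 := by rw [hzero]; simp
      rw [h0, zero_sub] at h1
      calc |δ * L1' - L1| = |-L1 + δ * L1'| := by ring_nf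
        _ ≤ 1269 / Real.log D * δ := h1
        _ ≤ 1269 / Real.log D * (2 * L1) :=
            mul_le_mul_of_nonneg_left (hδ₂.trans hτ₂L) (by positivity)
        _ = 2538 / Real.log D * L1 := by ring
    have h := ratio_bound hL1pos hZ0 hu hv hC₁abs
    refine h.trans ?_
    rw [hT_def]; apply le_of_eq; field_simp; ring
  · -- (1.5), second form: the quantity is the same (`L(1) = π h/√D`)
    have hq_eq : 6 * h / (P * Real.pi * Real.sqrt D) = L1 / Z := by
      rw [hL1, hZ_def]; field_simp
    rw [hq_eq]
    have hu : |δ * L1' - L1| ≤ 2538 / Real.log D * L1 := by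
      have h1 := hreal δ hδ0.le hδρ
      rw [hσ₀eq] at h1
      have h0 : (χ.LFunction (σ₀ : ℂ)).re = 0 := by rw [hzero]; simp
      rw [h0, zero_sub] at h1
      calc |δ * L1' - L1| = |-L1 + δ * L1'| := by ring_nf
        _ ≤ 1269 / Real.log D * δ := h1
        _ ≤ 1269 / Real.log D * (2 * L1) :=
            mul_le_mul_of_nonneg_left (hδ₂.trans hτ₂L) (by positivity)
        _ = 2538 / Real.log D * L1 := by ring
    have h := ratio_bound hL1pos hZ0 hu hv hC₁abs
    refine h.trans ?_
    rw [hT_def]; apply le_of_eq; field_simp; ring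
  · -- (1.6)
    intro s hs
    have hs1 := hmemH s hs
    have h1 := hKEY 1 s (by simp; exact hρ0.le) hs1
    rw [hderiv_real] at h1
    have hsplit : χ.LFunction s - χ.LFunction 1 - (s - 1) * ((Z : ℝ) : ℂ) =
        (χ.LFunction s - χ.LFunction 1 - (s - 1) * (L1' : ℂ)) + (s - 1) * ((L1' - Z : ℝ) : ℂ) := by
      push_cast; ring
    have hnorm2 : ‖(s - 1) * ((L1' - Z : ℝ) : ℂ)‖ ≤ ‖s - 1‖ * (|C₁| / Real.log D * Z) := by
      rw [norm_mul, Complex.norm_real, Real.norm_eq_abs]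
      exact mul_le_mul_of_nonneg_left hv (norm_nonneg _)
    have hnZ : ‖(s - 1) * ((Z : ℝ) : ℂ)‖ = ‖s - 1‖ * Z := by
      rw [norm_mul, Complex.norm_real, Real.norm_eq_abs, abs_of_pos hZ0]
    show ‖χ.LFunction s - χ.LFunction 1 - (s - 1) * ((P * (Real.pi ^ 2 / 6) : ℝ) : ℂ)‖ ≤
      ‖(s - 1) * ((P * (Real.pi ^ 2 / 6) : ℝ) : ℂ)‖ * T / Real.log D
    rw [← hZ_def, hsplit, hnZ]
    calc ‖χ.LFunction s - χ.LFunction 1 - (s - 1) * (L1' : ℂ) + (s - 1) * ((L1' - Z : ℝ) : ℂ)‖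
        ≤ ‖χ.LFunction s - χ.LFunction 1 - (s - 1) * (L1' : ℂ)‖ + ‖(s - 1) * ((L1' - Z : ℝ) : ℂ)‖ :=
          norm_add_le _ _
      _ ≤ 1269 / Real.log D * ‖s - 1‖ + ‖s - 1‖ * (|C₁| / Real.log D * Z) := add_le_add h1 hnorm2
      _ ≤ 1269 / Real.log D * (‖s - 1‖ * Z) + ‖s - 1‖ * (|C₁| / Real.log D * Z) := by
          have : ‖s - 1‖ ≤ ‖s - 1‖ * Z := le_mul_of_one_le_right (norm_nonneg _) hZ1
          have := mul_le_mul_of_nonneg_left this (show (0:ℝ) ≤ 1269 / Real.log D by positivity)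
          linarith
      _ = ‖s - 1‖ * Z * (1269 + |C₁|) / Real.log D := by ring
      _ ≤ ‖s - 1‖ * Z * T / Real.log D := by
          refine div_le_div_of_nonneg_right ?_ hlog0.le
          refine mul_le_mul_of_nonneg_left ?_ (by positivity)
          rw [hT_def]; linarith [abs_nonneg C₁]

end TheoremOneAssembly

/-- **Pintz 1976 (III), Theorem 1 — the named fact `pintz1976Deuring_theorem1` DISCHARGED**: for an
imaginary quadratic field `K` with `D = |d_K| > D₁` and `h_K ≤ log D/(2 log log D)`, and `χ` the
odd real primitive character mod `D`, `L(s, χ)` has a single simple real zero `1 − δ` in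
`H = {|1 − s| ≤ 1/log⁴D}`, `δ = (L(1)/(∏_{p∣D}(1+1/p)π²/6))(1 + O(1/log D)) =
6h_K(1 + O(1/log D))/(∏_{p∣D}(1+1/p)π√D)`, and `L(s) − L(1) = (s − 1)∏_{p∣D}(1+1/p)(π²/6)(1 + O(1/log D))`
on `H`. Road as printed (§2): Lemma 1 (`pintz1976Deuring_lemma1_holds`), Lemma 2 via (2.3)
`L'' = O(log³D)` and Lemma 3 via (2.4) (Part N), the sign change of `L(1 − τ)` between
`τ₁ = L(1)/(2L'(1))` and `τ₂ = 2L(1)/L'(1)` and the intermediate value theorem (Part O).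
[cite: Pintz1976ElementaryIII, Theorem 1 p. 296 (1.3)–(1.6), proof §2 pp. 297–298] -/
theorem _root_.Literature.NumberTheory.LFunctions.pintz1976Deuring_theorem1_holds :
    pintz1976Deuring_theorem1 := by
  obtain ⟨C, D₁, hD₁⟩ := theorem1_aux
  exact ⟨C, D₁, fun K _ _ _ h2 hd hD hh χ hquad hprim hodd =>
    hD₁ _ K h2 hd rfl hD hh χ hquad hprim hodd⟩

end Pintz1976Deuring

end Literature.NumberTheory.LFunctions

end
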